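import Summits.ABC.ABC.Theses.TwistAmplification
import Literature.NumberTheory.DiophantineGeometry.AbcShapeReductionCount
import Summits.ABC.ABC.Theorems.TwistAmplificationMazurKaneLawStubTransfer
import Summits.ABC.ABC.Theorems.TwistAmplificationMazurKaneLawStubOffWall
import Summits.ABC.ABC.Theorems.TwistAmplificationMazurKaneLawStubTwoRootTameX
import Summits.ABC.ABC.Theorems.TwistAmplificationMazurKaneLawStubTwoRootTameZ
import Summits.ABC.ABC.Theorems.TwistAmplificationMazurKaneLawRecordDEDefs

/-!
# Line `critical-kloosterman-powerful-moduli`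

**LEAD c3 (prover-line-stmt-ABC-2757-c3-0, 2026-08-16, wave 1).** The four PROVABLE stubs of v2 are LANDED (`--supports stmt-ABC-2757`):
`stub_transfer` p122825 (…StubTransfer.lean), `stub_offWall` p123117 (…StubOffWall.lean), `stub_twoRootTameX` p122974
(…StubTwoRootTameX.lean), `stub_twoRootTameZ` p123025 (…StubTwoRootTameZ.lean); below they are discharged BY NAME, so the `sorry`s of
this skeleton are exactly `stub_nearWallR2` (the critical bilinear Kloosterman-fraction input, square moduli) and `stub_deepResidual`
(foreign, (1,5/3) ∪ depth > 1/4). Everything else is lead -2's v2 verbatim.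
 — crux `TwistAmplification.MazurKaneLaw` (stmt-ABC-2757)

**LEAD v2 (prover-line-stmt-ABC-2757-2, 2026-08-16).** v1 = the crux-plan skeleton below (planner
planner-cruxplan-stmt-ABC-2757-critical-kloosterman-0; 4 stubs transfer / offWall / nearWall / deepResidual). v2 RESHAPES
THE LEVER `stub_nearWall` into three registered stubs with the same composition idea (kernel-checked glue
`nearWallAt_of_twoRoot`, `nearWallLaw_of`): `stub_twoRootTameX`, `stub_twoRootTameZ` (PROVABLE NOW: the new elementary
TWO-ROOT TOOL R₂ — host term's linear variable and the square variables of BOTH other terms free; `(z/y)² ≡ B/C (mod A)` is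
a coset of `μ₂(ℤ/A)`, each class a congruence lattice counted without skew term by the tree's
`card_coprime_congr_box_le`; host `Y` follows from host `X` by `shapeCount_swap`) and `stub_nearWallR2` (OPEN: near-wall data
with no R₂ certificate — by the lead's exponent analysis the two families `R(δ,1)`, `R(δ,2)` of its docstring). So the
skeleton is now: crux ⟸ {transfer, offWall, twoRootTameX, twoRootTameZ, nearWallR2, deepResidual} (`MazurKaneLaw_of`), and
`MazurKaneLaw` on `[15/8, 2)` ⟸ the first five (`mazurKaneLaw_high_of`, via `not_deep`). Everything else is v1 verbatim.

Skeleton of the line (crux-plan, planner-cruxplan-stmt-ABC-2757-critical-kloosterman-0, 2026-08-16) for the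
triaged crux idea `critical-kloosterman-powerful-moduli` (crux-ideate r1, ideator 1; triage r1: 3 × pass, all
three "unverified — card body unreadable in the triage jails"; the card body is ALSO unreadable in this planner
jail (`run/gate/evidence/**` not mounted), so the lever is reconstructed from the card's public metadata —
"spectral/Kloosterman lever for the wall family; first lemma `WallCubeSaving`, target `WallMazur`" — from the
three TRIAGE-r1-k.md analyses, and from the companion map line `Lines/fibre-toolkit-lp-wall-map.lean`).

THE CRUX. `MazurKaneLaw`: for every `1 < s < 2`, `ε > 0`: `#{abc triples, c ≤ N, rad(abc) ≤ c^s} ≤ C N^{s-1+ε}`.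

THE LINE, in the tree's shape language (`AbcShapes`: `a = c₁ ∏ᵢ xᵢ^{i+1}`, coordinate `0` LINEAR, `1` the
SQUARE level, `≥ 2` cube-full; a class at dyadic scale `C₀` has data `(C₀; c₁,c₂,c₃; X,Y,Z)`,
`AbcShapes.Admissible s ε`; `B = shapeCount`; `P = ∏ᵢ XᵢYᵢZᵢ ≤ (2C₀)^{s+3ε}`, `P₀ = X₀Y₀Z₀`, `P₁ = X₁Y₁Z₁`,
`R = C₀^{s-1+3ε}` = the law, `Θ³ = (c₁·shapeVal X)(c₂·shapeVal Y)(c₃·shapeVal Z)/(2C₀)³ ≤ 1` the deficiency).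

1. OFF THE WALL (`OffWallLaw`, provable now): if `P ≤ 2R·P₀` (GoN certificate) or
   `P ≤ 2R·P₁ ∧ P³ ≤ 64R³·Θ³(2C₀)³` (conic certificate) the law `B ≤ K C₀^{s-1+3ε+η}` follows from the two fibre
   tools of the tree — Kane/Bernert lattices in the linear variables (`shapeCount_succ_le` /
   `shapeCount_le_geometry_sets`: `B ≤ 2P/P₀ + 112V₂P/C₀`), resp. the SHARP CONIC (determinant method,
   `SquarefulDet.fiberBound`, `n = 1`, full modulus `|ABC| ≥ Θ³(2C₀)³/P₁²`: `B ≤ C₀^η(P/P₁ + P/(Θ·2C₀))`; both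
   terms are `≤ 4R` exactly under the two conic inequalities — the second one is where LOPSIDED triples
   `a ≪ c^{1-e}`, `Θ = C₀^{-e/3}`, pay their deficiency).
2. THE STRUCTURE INEQUALITY (proved below, `prod_cube_le`): `P³ ≤ Θ³(2C₀)³·P₀²·P₁`, because
   `∏ᵢ xᵢ^{i+1} ≥ x₀x₁²(∏_{i≥2}xᵢ)³`. Hence the complement of (1) — the BAD region, where Kane's "+1 per
   lattice" `2P/P₀` exceeds the law — has LINEAR DEPTH `P/(R P₀) ≤ 2C₀·P₀^{-1/3}(Θ³P₁)^{1/3}/R` (also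
   `P² ≤ Θ³(2C₀)³·P₀`, `prod_sq_le_three`, which controls the lopsided non-conic data), and its extreme
   point at exponent `s = 2 - δ` is the WALL FAMILY `P₀ = P₁ = C₀^{1-δ}`, `P₂ = C₀^{δ}`
   (`a, b, c = u·x²·w³`, `u ≍ x ≍ N^{(1-δ)/3}`, `w ≍ N^{δ/3}`; ideator 1's "P1 = P2 = X^{l-1}, P3 = X^{2-l}",
   ideator 2's enemy (2), TRIAGE r1-2/3's common enemy): `N` lattices `Λ = {(u₀,u₁) : a₃ ∣ a₁u₀ + a₂u₁}` of
   covolume `a₃ = c₃z₁²z₂³⋯ ≍ N^{(2+δ)/3}` probed in a box `U² = N^{2(1-δ)/3} < a₃` — sub-Minkowski, so Kane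
   counts `N` and the truth/law is `N^{1-δ}`; the SAVING NEEDED is the full depth `C₀^{δ}` (TRIAGE r1-2: "full
   saving forced").
3. THE LEVER (`NearWallLaw`, OPEN, hardest): on the bad region up to linear depth `1/4`
   (`P ≤ 2R·C₀^{1/4}·P₀`) the occupied lattices are as many as expected: `B ≤ K C₀^{s-1+3ε+η}`. WHY
   KLOOSTERMAN, WHY POWERFUL MODULI, WHY CRITICAL (the idea): the moduli `a₃ = c₃·z₁²z₂³z₃⁴⋯` of the
   linear-level lattices are SQUAREFULL up to the cofactor `c₃ ≤ (2C₀)^{ε/2}` — always, by construction of the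
   shape normal form — so after Poisson summation in `u₁` the dual sums
   `Σ_{k ≤ a₃/U} Σ_{u₀ ~ U} Σ_{y₁ ~ X₁} e(k·u₀·a₁·\overline{c₂ y₁² y₂³⋯}/a₃)` carry complete Kloosterman/Salié
   sums to squarefull moduli, which EVALUATE by `p`-adic stationary phase into explicit algebraic exponentials
   (Iwaniec–Kowalski §12.3), and the remaining incomplete sums have explicit phases to which `q`-van der Corput
   along `a₃ = (z₁z₂²)·(z₁z₂)` and the large sieve for square moduli apply; "critical" because on the wall
   `X₁ ≍ z₁ ≍ a₃^{1/2}·N^{-δ/2}` — the `y₁`-sums sit exactly at the completion / Pólya–Vinogradov threshold and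
   the differencing modulus `z₁z₂²` EXCEEDS the length `X₁` by `W²`, so single-modulus methods are void and
   the average over the `≍ N^{1/3}` moduli `z'` and over `k·u₀` (length `a₃`) must carry the cancellation.
   NUMBERS (symmetric wall, `s = 2-δ`): after Poisson in `u₁` the error term is trivially `N^{(4-δ)/3}`, the
   law is `N^{1-δ}`, so the `(k, u₀, y₁)`-sum of total length `N` must show cancellation `N^{(1+2δ)/3}`;
   square-root cancellation in these three variables gives exactly `δ ≤ 1/4`, which is where the depth
   `τ₀ = 1/4` of this skeleton comes from (it is also where the expected number `U³/a₃ = N^{(1-4δ)/3}` of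
   occupied `y₁` per `(x', z', y₂)`-family drops below `1`: beyond depth `1/4` the lever meets a second-order
   "+1" problem). A fixed power saving `ρ` at the critical point proves `NearWallLaw` with `1/4` replaced by a
   `τ₁(ρ) > 0` (reshape = that one constant) and still yields the FIRST range below Kane's `s ≥ 2` (side
   theorem below with `15/8` replaced by `2 - τ₁/2`).
4. THE DEEP RESIDUAL (`DeepResidualLaw`, open, FOREIGN — not attacked by this line, recorded so that the
   composition is honest about `∀ s ∈ (1,2)`): bad-region data of linear depth `> 1/4`. By (2) this region is
   EMPTY for `s ≥ 15/8` (`not_deep`, proved below: the symmetric-wall part already for `s ≥ 11/6`, the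
   lopsided conic-deficient part for `s ≥ 15/8`), non-empty below (symmetric wall of depth `δ > 1/4`,
   cube-heavy and twisted-Fermat boxes below `5/3`, and at `s → 1⁺` "abc hits `≪ N^{δ}`"); candidate levers on
   file: `peyre-level-torsor-v22` / `heegner-cusp-subholzer` (reach `5/3`), `aligned-power-curve-rigidity`.
5. TRANSFER (`TransferAt`, provable now): the shape law at every `l ∈ (s, 2)` gives the crux at `s` (tree
   reduction `abcExponentCount_le_of_shapeCount_le` + `card_classRange_le`; `rad ≤ c^s < c^l` absorbs `≤/<`).

`MazurKaneLaw_of` composes the four stubs into the crux BY NAME (kernel-checked, no `sorry` outside the four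
`stub_*`); `lawAt_of_offWall_nearWall` is the kernel-checked REACH of the line without the foreign stub:
transfer + off-wall + lever ⟹ the Mazur–Kane law for every `s ∈ [15/8, 2)`.

## Disproof used (cdisprove `Disproof.lean` 2026-08-15T22:51Z, 1151 lines rc 0; known through its four evidence
notes only — `run/gate/evidence/**` is not mounted here and `Cruxes/MazurKaneLaw/Disproof.lean` is not written)
* `mazurKaneLaw_false_without_eps` / `not_lawAt_zero` / `abcExponentCount_not_bigO` (ε load-bearing at EVERY
  `s`: `(1,c-1,c)`, `(xⁿ, rⁿ-xⁿ, rⁿ)` sit on `N^{s-1}·log N`) — HONOURED: every stub concludes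
  `≤ K C₀^{s-1+3ε+η}` for all `η > 0` (the `3ε` is the admissibility slack `P ≤ (2C₀)^{s+3ε}`, not a claim);
  nothing ε-free is stated. The line USES ε at `stub_nearWall` (divisor/`N^η` losses of completion) and at
  `stub_transfer` (room `s < l < 2`).
* `mazurKaneLaw_false_without_coprime` (dyadic family `≍ N^{3/4}` at `s = 3/2`) — HONOURED: all counts are
  `shapeCount` (the `gcd = 1` clause is inside `shapeTriples`); the lever NEEDS it (units modulo `a₃`:
  `a₁, a₂, u₀, u₁` coprime to `a₃` by `coprime_terms_of_mem`) — "the line uses coprimality at `stub_nearWall`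
  and `stub_offWall` (conic: `fiberBound`'s `hcu/hvc`)".
* `mazurKaneLaw_false_without_one_lt` (`s = 9/10`: hit `(1,8,9)`) — HONOURED: `TransferAt` is stated for
  `1 < s` and needs `s < l < 2`.
* `lawAt_of_three_le`, `tight_at_one_add_inv`, `lawAt_mono` — not engaged (all statements live on `(1,2)`);
  `abcHitCount_le_of_mazurKaneLaw` (crux ⇒ hits `≪ X^δ`) — consistent: that content sits in
  `stub_deepResidual`, flagged foreign.
* Landed `Theorems/MazurKaneLaw/Negative/`: none exists (checked 2026-08-16); `ledger negatives --problem ABC`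
  = stmt-ABC-1689, stmt-ABC-1205 (not about counting) — no stub is an instance of either.
-/

noncomputable section

-- `Summit.<Summit>.<Problem>`-style duplicate `ABC.ABC` is deliberate (single-conjunct summit; lakefile sets the same).
set_option linter.dupNamespace false

open Finset
open Literature.NumberTheory.DiophantineGeometry
open Literature.NumberTheory.DiophantineGeometry.AbcShapes

namespace Summit.ABC.ABC.Cruxes.MazurKaneLaw.CriticalKloostermanPowerfulModuli

/-! ## The statements (named `Prop`s over tree declarations; the registered `stub_*` theorems restate them
verbatim and fully qualified; `Registered.stub_*` are the name-keyed aliases taken as hypotheses of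
`MazurKaneLaw_of` — the skeleton audit admits a hypothesis whose head's last name component is a declared stub,
same device as `Lines/fibre-toolkit-lp-wall-map.lean`) -/

/-- The LINEAR DEPTH up to which the lever is claimed: `τ₀ = 1/4` (documentation constant; the registered
signatures inline the literal `1 / 4`). Reshaping the line to a proved critical saving `ρ` = replacing this
literal (and `15 / 8 = 2 - τ₀/2` in `not_deep` / `lawAt_of_offWall_nearWall`). -/
def depth : ℝ := 1 / 4

/-- The Mazur–Kane law AT ONE EXPONENT `s` — literally the body of the crux
`Summit.ABC.ABC.Theses.TwistAmplification.MazurKaneLaw` (see `mazurKaneLaw_iff`). -/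
def LawAt (s : ℝ) : Prop :=
  ∀ ε : ℝ, 0 < ε → ∃ C : ℝ, ∀ N : ℕ, 2 ≤ N →
    (Set.ncard {t : ℕ × ℕ × ℕ | IsABCTriple t.1 t.2.1 t.2.2 ∧ t.2.2 ≤ N ∧
      ((rad t.1 t.2.1 t.2.2 : ℕ) : ℝ) ≤ (t.2.2 : ℝ) ^ s} : ℝ) ≤ C * (N : ℝ) ^ (s - 1 + ε)

/-- The crux is `LawAt` at every `s ∈ (1, 2)`, definitionally. -/
theorem mazurKaneLaw_iff :
    Summit.ABC.ABC.Theses.TwistAmplification.MazurKaneLaw ↔ ∀ s : ℝ, 1 < s → s < 2 → LawAt s :=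
  Iff.rfl

/-- THE SHAPE LAW at exponent `l`: `B_M(c; X, Y, Z) ≤ K · C₀^{l-1+3ε+η}` for all data admissible for `(l, ε)`
(`M = ⌊10/ε²⌋` levels), every `η > 0`. Implied by the crux at `l + O(ε)` together with Kane's theorem above `2`
(a counted shape solution is an abc triple with `c ∈ [C₀/V₂, 2C₀]`, `rad ≤ 8^M (2C₀)^{l+9ε/2}`, represented
`≤ τ_M³ = C₀^{o(1)}` times), so regional pieces of it are pieces of the conjecture, not strengthenings. -/
def ShapeLawAt (l : ℝ) : Prop :=
  ∀ ε : ℝ, 0 < ε → ε < 1 / 2 → ∀ η : ℝ, 0 < η → ∃ K : ℝ,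
    ∀ (C₀ c₁ c₂ c₃ : ℕ) (X Y Z : Fin (numShapes ε) → ℕ),
      Admissible l ε C₀ c₁ c₂ c₃ X Y Z →
        (shapeCount c₁ c₂ c₃ X Y Z : ℝ) ≤ K * (C₀ : ℝ) ^ (l - 1 + 3 * ε + η)

/-- OFF-WALL law at `l`: the shape law on the data certified by one of the two tree tools: `P ≤ 2R·P₀`
(`R = C₀^{l-1+3ε}`; Kane's lattices in the linear variables) or `P ≤ 2R·P₁ ∧ P³ ≤ 64R³·A`,
`A = (c₁·shapeVal X)(c₂·shapeVal Y)(c₃·shapeVal Z) = Θ³(2C₀)³` (the sharp conic with full modulus). The indices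
`i₀, i₁` are the coordinates `0, 1` of `Fin M` (they exist: `M ≥ 40` for `ε < 1/2`, `two_le_numShapes`). -/
def OffWallAt (l : ℝ) : Prop :=
  ∀ ε : ℝ, 0 < ε → ε < 1 / 2 → ∀ η : ℝ, 0 < η → ∃ K : ℝ,
    ∀ (C₀ c₁ c₂ c₃ : ℕ) (X Y Z : Fin (numShapes ε) → ℕ) (i₀ i₁ : Fin (numShapes ε)),
      (i₀ : ℕ) = 0 → (i₁ : ℕ) = 1 → Admissible l ε C₀ c₁ c₂ c₃ X Y Z →
        ((∏ i, ((X i : ℝ) * Y i * Z i)) ≤ 2 * (C₀ : ℝ) ^ (l - 1 + 3 * ε) * ((X i₀ : ℝ) * Y i₀ * Z i₀) ∨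
          ((∏ i, ((X i : ℝ) * Y i * Z i)) ≤ 2 * (C₀ : ℝ) ^ (l - 1 + 3 * ε) * ((X i₁ : ℝ) * Y i₁ * Z i₁) ∧
            (∏ i, ((X i : ℝ) * Y i * Z i)) ^ 3 ≤ 64 * ((C₀ : ℝ) ^ (l - 1 + 3 * ε)) ^ 3 *
              (((c₁ * shapeVal X : ℕ) : ℝ) * ((c₂ * shapeVal Y : ℕ) : ℝ) * ((c₃ * shapeVal Z : ℕ) : ℝ)))) →
          (shapeCount c₁ c₂ c₃ X Y Z : ℝ) ≤ K * (C₀ : ℝ) ^ (l - 1 + 3 * ε + η)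

/-- NEAR-WALL law at `l` (the LEVER's claim): the shape law on the bad region (not off-wall) up to linear depth
`1/4`: `P ≤ 2R·C₀^{1/4}·P₀`. -/
def NearWallAt (l : ℝ) : Prop :=
  ∀ ε : ℝ, 0 < ε → ε < 1 / 2 → ∀ η : ℝ, 0 < η → ∃ K : ℝ,
    ∀ (C₀ c₁ c₂ c₃ : ℕ) (X Y Z : Fin (numShapes ε) → ℕ) (i₀ i₁ : Fin (numShapes ε)),
      (i₀ : ℕ) = 0 → (i₁ : ℕ) = 1 → Admissible l ε C₀ c₁ c₂ c₃ X Y Z →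
        ¬ ((∏ i, ((X i : ℝ) * Y i * Z i)) ≤ 2 * (C₀ : ℝ) ^ (l - 1 + 3 * ε) * ((X i₀ : ℝ) * Y i₀ * Z i₀) ∨
          ((∏ i, ((X i : ℝ) * Y i * Z i)) ≤ 2 * (C₀ : ℝ) ^ (l - 1 + 3 * ε) * ((X i₁ : ℝ) * Y i₁ * Z i₁) ∧
            (∏ i, ((X i : ℝ) * Y i * Z i)) ^ 3 ≤ 64 * ((C₀ : ℝ) ^ (l - 1 + 3 * ε)) ^ 3 *
              (((c₁ * shapeVal X : ℕ) : ℝ) * ((c₂ * shapeVal Y : ℕ) : ℝ) * ((c₃ * shapeVal Z : ℕ) : ℝ)))) →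
        (∏ i, ((X i : ℝ) * Y i * Z i)) ≤
            2 * (C₀ : ℝ) ^ (l - 1 + 3 * ε) * (C₀ : ℝ) ^ (1 / 4 : ℝ) * ((X i₀ : ℝ) * Y i₀ * Z i₀) →
          (shapeCount c₁ c₂ c₃ X Y Z : ℝ) ≤ K * (C₀ : ℝ) ^ (l - 1 + 3 * ε + η)

/-- DEEP law at `l` (the foreign RESIDUAL): the shape law on the bad region beyond linear depth `1/4`. Vacuous
for `l ≥ 15/8` (`not_deep`). -/
def DeepAt (l : ℝ) : Prop :=
  ∀ ε : ℝ, 0 < ε → ε < 1 / 2 → ∀ η : ℝ, 0 < η → ∃ K : ℝ,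
    ∀ (C₀ c₁ c₂ c₃ : ℕ) (X Y Z : Fin (numShapes ε) → ℕ) (i₀ i₁ : Fin (numShapes ε)),
      (i₀ : ℕ) = 0 → (i₁ : ℕ) = 1 → Admissible l ε C₀ c₁ c₂ c₃ X Y Z →
        ¬ ((∏ i, ((X i : ℝ) * Y i * Z i)) ≤ 2 * (C₀ : ℝ) ^ (l - 1 + 3 * ε) * ((X i₀ : ℝ) * Y i₀ * Z i₀) ∨
          ((∏ i, ((X i : ℝ) * Y i * Z i)) ≤ 2 * (C₀ : ℝ) ^ (l - 1 + 3 * ε) * ((X i₁ : ℝ) * Y i₁ * Z i₁) ∧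
            (∏ i, ((X i : ℝ) * Y i * Z i)) ^ 3 ≤ 64 * ((C₀ : ℝ) ^ (l - 1 + 3 * ε)) ^ 3 *
              (((c₁ * shapeVal X : ℕ) : ℝ) * ((c₂ * shapeVal Y : ℕ) : ℝ) * ((c₃ * shapeVal Z : ℕ) : ℝ)))) →
        ¬ ((∏ i, ((X i : ℝ) * Y i * Z i)) ≤
            2 * (C₀ : ℝ) ^ (l - 1 + 3 * ε) * (C₀ : ℝ) ^ (1 / 4 : ℝ) * ((X i₀ : ℝ) * Y i₀ * Z i₀)) →
          (shapeCount c₁ c₂ c₃ X Y Z : ℝ) ≤ K * (C₀ : ℝ) ^ (l - 1 + 3 * ε + η)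

/-- The R₂ CERTIFICATE WITH HOST `X` (the `a`-term) at the law `R = C₀^{l-1+3ε}`: `P ≤ 2R·X₀Y₁Z₁` (number of
fibres of the two-root tool ≤ law) and `P ≤ R·(c₁ shapeVal X)` (its main term ≤ law; not automatic because `a` may be
small). `i₀, i₁` are the coordinates `0, 1`. -/
def CertX (l ε : ℝ) {M : ℕ} (C₀ c₁ : ℕ) (X Y Z : Fin M → ℕ) (i₀ i₁ : Fin M) : Prop :=
  (∏ i, ((X i : ℝ) * Y i * Z i)) ≤ 2 * (C₀ : ℝ) ^ (l - 1 + 3 * ε) * ((X i₀ : ℝ) * Y i₁ * Z i₁) ∧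
    (∏ i, ((X i : ℝ) * Y i * Z i)) ≤ (C₀ : ℝ) ^ (l - 1 + 3 * ε) * ((c₁ * shapeVal X : ℕ) : ℝ)

/-- The R₂ CERTIFICATE WITH HOST `Y` (the `b`-term): `P ≤ 2R·Y₀X₁Z₁ ∧ P ≤ R·(c₂ shapeVal Y)`. -/
def CertY (l ε : ℝ) {M : ℕ} (C₀ c₂ : ℕ) (X Y Z : Fin M → ℕ) (i₀ i₁ : Fin M) : Prop :=
  (∏ i, ((X i : ℝ) * Y i * Z i)) ≤ 2 * (C₀ : ℝ) ^ (l - 1 + 3 * ε) * ((Y i₀ : ℝ) * X i₁ * Z i₁) ∧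
    (∏ i, ((X i : ℝ) * Y i * Z i)) ≤ (C₀ : ℝ) ^ (l - 1 + 3 * ε) * ((c₂ * shapeVal Y : ℕ) : ℝ)

/-- The R₂ CERTIFICATE WITH HOST `Z` (the `c`-term): `P ≤ 2R·Z₀X₁Y₁` (the main term is automatic from
`Admissible.le_valZ`). -/
def CertZ (l ε : ℝ) {M : ℕ} (C₀ : ℕ) (X Y Z : Fin M → ℕ) (i₀ i₁ : Fin M) : Prop :=
  (∏ i, ((X i : ℝ) * Y i * Z i)) ≤ 2 * (C₀ : ℝ) ^ (l - 1 + 3 * ε) * ((Z i₀ : ℝ) * X i₁ * Y i₁)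

/-- TWO-ROOT law with host `X` at `l`: the shape law on R₂-`X`-certified admissible data (lead v2). -/
def TwoRootTameXAt (l : ℝ) : Prop :=
  ∀ ε : ℝ, 0 < ε → ε < 1 / 2 → ∀ η : ℝ, 0 < η → ∃ K : ℝ,
    ∀ (C₀ c₁ c₂ c₃ : ℕ) (X Y Z : Fin (numShapes ε) → ℕ) (i₀ i₁ : Fin (numShapes ε)),
      (i₀ : ℕ) = 0 → (i₁ : ℕ) = 1 → Admissible l ε C₀ c₁ c₂ c₃ X Y Z → CertX l ε C₀ c₁ X Y Z i₀ i₁ →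
        (shapeCount c₁ c₂ c₃ X Y Z : ℝ) ≤ K * (C₀ : ℝ) ^ (l - 1 + 3 * ε + η)

/-- TWO-ROOT law with host `Y` at `l` (derived from host `X` by symmetry, `twoRootTameYAt_of_X`). -/
def TwoRootTameYAt (l : ℝ) : Prop :=
  ∀ ε : ℝ, 0 < ε → ε < 1 / 2 → ∀ η : ℝ, 0 < η → ∃ K : ℝ,
    ∀ (C₀ c₁ c₂ c₃ : ℕ) (X Y Z : Fin (numShapes ε) → ℕ) (i₀ i₁ : Fin (numShapes ε)),
      (i₀ : ℕ) = 0 → (i₁ : ℕ) = 1 → Admissible l ε C₀ c₁ c₂ c₃ X Y Z → CertY l ε C₀ c₂ X Y Z i₀ i₁ →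
        (shapeCount c₁ c₂ c₃ X Y Z : ℝ) ≤ K * (C₀ : ℝ) ^ (l - 1 + 3 * ε + η)

/-- TWO-ROOT law with host `Z` at `l`: the shape law on R₂-`Z`-certified admissible data (lead v2). -/
def TwoRootTameZAt (l : ℝ) : Prop :=
  ∀ ε : ℝ, 0 < ε → ε < 1 / 2 → ∀ η : ℝ, 0 < η → ∃ K : ℝ,
    ∀ (C₀ c₁ c₂ c₃ : ℕ) (X Y Z : Fin (numShapes ε) → ℕ) (i₀ i₁ : Fin (numShapes ε)),
      (i₀ : ℕ) = 0 → (i₁ : ℕ) = 1 → Admissible l ε C₀ c₁ c₂ c₃ X Y Z → CertZ l ε C₀ X Y Z i₀ i₁ →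
        (shapeCount c₁ c₂ c₃ X Y Z : ℝ) ≤ K * (C₀ : ℝ) ^ (l - 1 + 3 * ε + η)

/-- NEAR-WALL RESIDUE after R₂ at `l` (lead v2; the OPEN stub): the shape law on admissible near-wall data (not off-wall,
linear depth `≤ C₀^{1/4}`) carrying no R₂ certificate for any host. -/
def NearWallR2At (l : ℝ) : Prop :=
  ∀ ε : ℝ, 0 < ε → ε < 1 / 2 → ∀ η : ℝ, 0 < η → ∃ K : ℝ,
    ∀ (C₀ c₁ c₂ c₃ : ℕ) (X Y Z : Fin (numShapes ε) → ℕ) (i₀ i₁ : Fin (numShapes ε)),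
      (i₀ : ℕ) = 0 → (i₁ : ℕ) = 1 → Admissible l ε C₀ c₁ c₂ c₃ X Y Z →
        ¬ ((∏ i, ((X i : ℝ) * Y i * Z i)) ≤ 2 * (C₀ : ℝ) ^ (l - 1 + 3 * ε) * ((X i₀ : ℝ) * Y i₀ * Z i₀) ∨
          ((∏ i, ((X i : ℝ) * Y i * Z i)) ≤ 2 * (C₀ : ℝ) ^ (l - 1 + 3 * ε) * ((X i₁ : ℝ) * Y i₁ * Z i₁) ∧
            (∏ i, ((X i : ℝ) * Y i * Z i)) ^ 3 ≤ 64 * ((C₀ : ℝ) ^ (l - 1 + 3 * ε)) ^ 3 *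
              (((c₁ * shapeVal X : ℕ) : ℝ) * ((c₂ * shapeVal Y : ℕ) : ℝ) * ((c₃ * shapeVal Z : ℕ) : ℝ)))) →
        (∏ i, ((X i : ℝ) * Y i * Z i)) ≤
            2 * (C₀ : ℝ) ^ (l - 1 + 3 * ε) * (C₀ : ℝ) ^ (1 / 4 : ℝ) * ((X i₀ : ℝ) * Y i₀ * Z i₀) →
        ¬ (CertX l ε C₀ c₁ X Y Z i₀ i₁ ∨ CertY l ε C₀ c₂ X Y Z i₀ i₁ ∨ CertZ l ε C₀ X Y Z i₀ i₁) →
          (shapeCount c₁ c₂ c₃ X Y Z : ℝ) ≤ K * (C₀ : ℝ) ^ (l - 1 + 3 * ε + η)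

/-- Statement of STUB 1 — TRANSFER, pointwise in `s`: the shape law at every `l ∈ (s, 2)` gives the crux at `s`. -/
def TransferAt : Prop :=
  ∀ s : ℝ, 1 < s → s < 2 → (∀ l : ℝ, s < l → l < 2 → ShapeLawAt l) → LawAt s

/-- Statement of STUB 2 — the OFF-WALL law at every `l ∈ (1, 2)`. -/
def OffWallLaw : Prop :=
  ∀ l : ℝ, 1 < l → l < 2 → OffWallAt l

/-- Statement of STUB 3 — the NEAR-WALL law (the lever) at every `l ∈ (1, 2)`. -/
def NearWallLaw : Prop :=
  ∀ l : ℝ, 1 < l → l < 2 → NearWallAt l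

/-- Statement of STUB 3a — the two-root law with host `X` at every `l ∈ (1, 2)` (lead v2). -/
def TwoRootTameXLaw : Prop :=
  ∀ l : ℝ, 1 < l → l < 2 → TwoRootTameXAt l

/-- Statement of STUB 3b — the two-root law with host `Z` at every `l ∈ (1, 2)` (lead v2). -/
def TwoRootTameZLaw : Prop :=
  ∀ l : ℝ, 1 < l → l < 2 → TwoRootTameZAt l

/-- Statement of STUB 3c — the near-wall residue after R₂ at every `l ∈ (1, 2)` (lead v2; OPEN). -/
def NearWallR2Law : Prop :=
  ∀ l : ℝ, 1 < l → l < 2 → NearWallR2At l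

/-- Statement of STUB 4 — the DEEP residual law at every `l ∈ (1, 2)` (vacuous for `l ≥ 15/8`). -/
def DeepResidualLaw : Prop :=
  ∀ l : ℝ, 1 < l → l < 2 → DeepAt l

/-! ## The registered stubs (`sorry` lives only here; signatures verbatim, `let`-free, fully qualified, so that a
Theorems-side `propose --supports stmt-ABC-2757` proof can restate them textually) -/

/-- **STUB 1 · `stub_transfer`** (M, PROVABLE NOW) — the shape law at every `l ∈ (s,2)` implies the crux at `s`.
The work (pattern of `bernertEtAl2024_thm_1_2_holds` / `_1_3_holds` in `AbcExceptionalSetBounds*Proofs`): given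
`1 < s < 2`, `ε > 0`, put `l = min(s + ε/4, (s+2)/2) ∈ (s, 2)`, `ε' = min(ε/20, 1/4)`, `η = ε/8`; an abc triple
has `c ≥ 2`, so `rad ≤ c^s < c^l` and the crux's set at `(s, N)` lies in the set of `abcExponentCount l N`
(`abcExponentCount_finite`, `Set.ncard_le_ncard`); the shape law at `(l, ε', η)` with `K ↦ max K 0` feeds
`abcExponentCount_le_of_shapeCount_le` (`θ = l - 1 + 3ε' + η ≥ 0`), and `card_classRange_le ε' (δ := ε/8)` bounds
the classes by `C' N^{3ε'/2 + ε/8}`; the exponents add to `≤ s - 1 + 29ε/40 ≤ s - 1 + ε`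
(`Real.rpow_le_rpow_of_exponent_le`, `N ≥ 1`). Honours `mazurKaneLaw_false_without_one_lt` (room `s < l < 2`)
and keeps `+ε`. Leans on: `AbcShapes.abcExponentCount_le_of_shapeCount_le`, `AbcShapes.card_classRange_le`,
`abcExponentCount_def`, `abcExponentCount_finite`. -/
theorem stub_transfer : ∀ s : ℝ, 1 < s → s < 2 → (∀ l : ℝ, s < l → l < 2 → ∀ ε : ℝ, 0 < ε → ε < 1 / 2 → ∀ η : ℝ, 0 < η → ∃ K : ℝ, ∀ (C₀ c₁ c₂ c₃ : ℕ) (X Y Z : Fin (Literature.NumberTheory.DiophantineGeometry.AbcShapes.numShapes ε) → ℕ), Literature.NumberTheory.DiophantineGeometry.AbcShapes.Admissible l ε C₀ c₁ c₂ c₃ X Y Z → (Literature.NumberTheory.DiophantineGeometry.AbcShapes.shapeCount c₁ c₂ c₃ X Y Z : ℝ) ≤ K * (C₀ : ℝ) ^ (l - 1 + 3 * ε + η)) → ∀ ε : ℝ, 0 < ε → ∃ C : ℝ, ∀ N : ℕ, 2 ≤ N → (Set.ncard {t : ℕ × ℕ × ℕ | Literature.NumberTheory.DiophantineGeometry.IsABCTriple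 t.1 t.2.1 t.2.2 ∧ t.2.2 ≤ N ∧ ((Literature.NumberTheory.DiophantineGeometry.rad t.1 t.2.1 t.2.2 : ℕ) : ℝ) ≤ (t.2.2 : ℝ) ^ s} : ℝ) ≤ C * (N : ℝ) ^ (s - 1 + ε) :=
  Summit.ABC.ABC.Theorems.MazurKaneLaw.stub_transfer

/-- **STUB 2 · `stub_offWall`** (L, PROVABLE NOW) — OFF THE WALL THE TWO TREE TOOLS GIVE THE LAW: for
`1 < l < 2`, `0 < ε < 1/2`, `η > 0` there is `K` with `B_M ≤ K C₀^{l-1+3ε+η}` on every admissible datum with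
`P ≤ 2R·P₀ ∨ (P ≤ 2R·P₁ ∧ P³ ≤ 64R³A)`, `A = (c₁ shapeVal X)(c₂ shapeVal Y)(c₃ shapeVal Z)`. The work: with
`V₂ = shapeVal (2,…,2) = 2^{M(M+1)/2}`, admissibility gives `c₃ shapeVal Z ≥ C₀/V₂` (`le_valZ`) and
`P ≤ (2C₀)^{l+3ε}` (`prod_le`). (a) `P ≤ 2RP₀`: `shapeCount_succ_le` (state it for `Fin (d+1)`, `cases` on
`numShapes ε`; or `shapeCount_le_geometry_sets` with `I = J = K = {i₀}` and the divisor factor `D ≪ C₀^{η}`,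
`Sieve.exists_card_divisors_le_mul_rpow` as in `AbcShapeEndgame`): `B ≤ 2P/P₀ + 112 V₂ P/C₀ ≤ (4 + 112V₂2^{l+3ε}) C₀^{l-1+3ε}`.
(b) `P ≤ 2RP₁ ∧ P³ ≤ 64R³A`: fibre `shapeTriples` over the variables off coordinate `i₁` (`subBox` pattern of
`AbcShapeGeometrySets`); on a non-empty fibre `A'x² + B'y² = C'z²` with `A' = c₁·∏_{i≠1}xᵢ^{i+1} ≥ c₁ shapeVal X/X₁²`,
pairwise coprime coefficients and unknowns (`coprime_terms_of_mem`), so `SquarefulDet.fiberBound` (`n = 1`,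
`e = 1`, `v = (A',B',C')`, auxiliary prime `p ∈ (P', 2P']` from Bertrand with `P'³ ≍ 48 X₁Y₁Z₁/(A'B'C') + polylog`,
`A'B'C' ≥ A/P₁²`) gives `≤ 36p · 8 · 2^{ω(A'B'C')} ≪ C₀^{η}(1 + (P₁³/A)^{1/3})` points per fibre; summing over the
`P/P₁` fibres: `B ≪ C₀^{η}(P/P₁ + P/A^{1/3})`, and `P/P₁ ≤ 2R`, `P/A^{1/3} ≤ 4R` are exactly the two hypotheses.
This is the content of the map line's `DetTool`/`ToolkitTame` (`Lines/fibre-toolkit-lp-wall-map.lean`) restricted to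
the two certificates that matter here; whichever lands first serves both lines. Why it might need reshaping:
bookkeeping only (casts; `fiberBound`'s `Icc (-Z) Z` box vs `Ico X (2X)`; `2^{ω} ≤ τ ≪ C₀^{η}`; small `C₀` into `K`).
Uses coprimality (honours `mazurKaneLaw_false_without_coprime`). Leans on: `shapeCount_succ_le`,
`shapeCount_le_geometry_sets`, `SquarefulDet.fiberBound`, `card_box_filter_coprime_congr_le`,
`Admissible.le_valZ/prod_le/valX_le`, `Sieve.exists_card_divisors_le_mul_rpow`, `Nat.exists_prime_lt_and_le_two_mul`. -/
theorem stub_offWall : ∀ l : ℝ, 1 < l → l < 2 → ∀ ε : ℝ, 0 < ε → ε < 1 / 2 → ∀ η : ℝ, 0 < η → ∃ K : ℝ, ∀ (C₀ c₁ c₂ c₃ : ℕ) (X Y Z : Fin (Literature.NumberTheory.DiophantineGeometry.AbcShapes.numShapes ε) → ℕ) (i₀ i₁ : Fin (Literature.NumberTheory.DiophantineGeometry.AbcShapes.numShapes ε)), (i₀ : ℕ) = 0 → (i₁ : ℕ) = 1 → Literature.NumberTheory.DiophantineGeometry.AbcShapes.Admissible l ε C₀ c₁ c₂ c₃ X Y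 Z → ((∏ i, ((X i : ℝ) * Y i * Z i)) ≤ 2 * (C₀ : ℝ) ^ (l - 1 + 3 * ε) * ((X i₀ : ℝ) * Y i₀ * Z i₀) ∨ ((∏ i, ((X i : ℝ) * Y i * Z i)) ≤ 2 * (C₀ : ℝ) ^ (l - 1 + 3 * ε) * ((X i₁ : ℝ) * Y i₁ * Z i₁) ∧ (∏ i, ((X i : ℝ) * Y i * Z i)) ^ 3 ≤ 64 * ((C₀ : ℝ) ^ (l - 1 + 3 * ε)) ^ 3 * (((c₁ * Literature.NumberTheory.DiophantineGeometry.AbcShapes.shapeVal X : ℕ) : ℝ) * ((c₂ * Literature.NumberTheory.DiophantineGeometry.AbcShapes.shapeVal Y : ℕ) : ℝ) * ((c₃ * Literature.NumberTheory.DiophantineGeometry.AbcShapes.shapeVal Z : ℕ) : ℝ)))) → (Literature.NumberTheory.DiophantineGeometry.AbcShapes.shapeCount c₁ c₂ c₃ X Y Z : ℝ) ≤ K * (C₀ : ℝ) ^ (l - 1 + 3 * ε + η) :=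
  Summit.ABC.ABC.Theorems.MazurKaneLaw.stub_offWall

/-- **STUB 3a · `stub_twoRootTameX`** (L, PROVABLE NOW — lead v2 reshape) — THE TWO-ROOT TOOL, HOST `a`, AS A LAW: for
`1 < l < 2`, `0 < ε < 1/2`, `η > 0` there is `K` with `B_M ≤ K C₀^{l-1+3ε+η}` on every admissible datum carrying the
R₂ certificate with host `X` (the `a`-term): `P ≤ 2R·X₀Y₁Z₁ ∧ P ≤ R·(c₁·shapeVal X)` (`P = ∏ XᵢYᵢZᵢ`, `R = C₀^{l-1+3ε}`,
`i₀ = 0` the linear coordinate, `i₁ = 1` the square coordinate). THE TOOL (multiplicative form, to be proved inside the stub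
file as a lemma in the pattern of `Summit.ABC.ABC.Theorems.MazurKaneLaw.detTool`): freeze every coordinate except `x₀` (linear
of `X`), `y₁`, `z₁` (square coordinates of `Y`, `Z`); the fibres are indexed by `subBox {i₀} X × subBox {i₁} Y × subBox {i₁} Z`
(`#fibres = P_nat/(X₀Y₁Z₁)`); on the fibre over `(r₁, r₂, r₃)` the equation is `A x₀ + B y² = C z²` with
`A = c₁·offVal {i₀} r₁ ≥ A₀ := c₁·offVal {i₀} X`, `B = c₂·offVal {i₁} r₂`, `C = c₃·offVal {i₁} r₃`, and
`gcd(A x₀, B y²) = 1` (`AbcShapes.coprime_terms_of_mem`), so `B, C, y, z` are units mod `A` and `gcd(y, z) = 1`; hence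
`(z·y⁻¹)² ≡ B·C⁻¹ (mod A)`: the admissible ratios form a coset of `μ₂(ℤ/A)`, at most `#{ρ : ZMod A // ρ^2 = 1} ≤ Dτ³` classes
(`Summit.ABC.ABC.Theorems.MazurKaneLaw.natCard_rootsOfUnity_le_pow` with `n = 1`, `τ(A) ≤ Dτ` for `A ≤ T`); for each class
with integer lift `t`, the pairs `(y, z)` lie on the congruence lattice `A ∣ t·y − z` with `gcd(t, −1, A) = 1`, and
`Literature.NumberTheory.DiophantineGeometry.card_coprime_congr_box_le` (box `|y| ≤ 2Y₁`, `|z| ≤ 2Z₁`, coprime points) gives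
`≤ 2 + 28·(2Y₁)(2Z₁)/A ≤ 2 + 112·Y₁Z₁/A₀` of them; `x₀ = (C z² − B y²)/A` is then determined. So
`B_d ≤ #fibres · Dτ³ · (2 + 112·Y₁Z₁/A₀)`, i.e. `B ≤ Dτ³ (2P/(X₀Y₁Z₁) + 112·P/(c₁ shapeVal X))` (`A₀·X₀ = c₁·shapeVal X` since
`onVal {i₀} X = X₀`), and under the certificate both terms are `≤ 4 Dτ³ R`, `≤ 112 Dτ³ R`; the divisor bound `Dτ ≪_η C₀^{η/3}`
for moduli `≤ T = c₁·shapeVal(2X) ≤ 2^{M(M+1)/2}·2C₀` comes from `Sieve.exists_card_divisors_le_mul_rpow` exactly as in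
`Theorems/TwistAmplificationMazurKaneLawToolkitTame.lean` (`det_linear` / `shapeCount_le_of_certified` endgame; small `C₀` into `K`).
WHY NEW: the kit's geometry tool frees LINEAR variables only and its root tool frees ONE power variable; freeing the two
square variables of the non-host terms together is what certifies AT THE LAW the "spread" boxes holding the kit+root plateau
`V = 1` on `[7/4, 2)` (drefute g2, `DrefuteFibreToolkitLpWallMap.md`): `s = 1.85`: `a = u w³ (.4,.2)`, `b = u x² (.2,.4)`,
`c = u x² (.2,.4)` → host `a`: `N^{.6}` fibres × `N^{.2}` = `N^{.8} = N^{L-1}`. Uses coprimality twice (units mod `A`; `gcd(y,z)=1`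
is what removes the skew term from the lattice count) — honours `mazurKaneLaw_false_without_coprime`. Leans on (tree, all
proved): `AbcShapes.shapeCount`, `subBox`/`offVal`/`freezeOn` API (`AbcShapeSubBox`), `coprime_terms_of_mem`,
`card_coprime_congr_box_le` (`CongruenceLatticeBoxCount`), `natCard_rootsOfUnity_le_pow` (`…DetToolRoots`), `Admissible.*`,
`Sieve.exists_card_divisors_le_mul_rpow`; patterns: `…DetTool.lean` (fibring), `…ToolkitTame.lean` (exponent endgame). -/
theorem stub_twoRootTameX : ∀ l : ℝ, 1 < l → l < 2 → ∀ ε : ℝ, 0 < ε → ε < 1 / 2 → ∀ η : ℝ, 0 < η → ∃ K : ℝ, ∀ (C₀ c₁ c₂ c₃ : ℕ) (X Y Z : Fin (Literature.NumberTheory.DiophantineGeometry.AbcShapes.numShapes ε) → ℕ) (i₀ i₁ : Fin (Literature.NumberTheory.DiophantineGeometry.AbcShapes.numShapes ε)), (i₀ : ℕ) = 0 → (i₁ : ℕ) = 1 → Literature.NumberTheory.DiophantineGeometry.AbcShapes.Admissible l ε C₀ c₁ c₂ c₃ X Y Z → ((∏ i, ((X i : ℝ) * Y i * Z i)) ≤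 2 * (C₀ : ℝ) ^ (l - 1 + 3 * ε) * ((X i₀ : ℝ) * Y i₁ * Z i₁) ∧ (∏ i, ((X i : ℝ) * Y i * Z i)) ≤ (C₀ : ℝ) ^ (l - 1 + 3 * ε) * ((c₁ * Literature.NumberTheory.DiophantineGeometry.AbcShapes.shapeVal X : ℕ) : ℝ)) → (Literature.NumberTheory.DiophantineGeometry.AbcShapes.shapeCount c₁ c₂ c₃ X Y Z : ℝ) ≤ K * (C₀ : ℝ) ^ (l - 1 + 3 * ε + η) :=
  Summit.ABC.ABC.Theorems.MazurKaneLaw.stub_twoRootTameX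

/-- **STUB 3b · `stub_twoRootTameZ`** (L, PROVABLE NOW — lead v2 reshape) — THE TWO-ROOT TOOL, HOST `c`, AS A LAW: as
`stub_twoRootTameX` with host `Z` (the `c`-term): free `z₀` (linear of `Z`), `x₁`, `y₁`; on a fibre `A x² + B y² = C z₀`, so
`(x·y⁻¹)² ≡ −B·A⁻¹ (mod C)`, a coset of `μ₂(ℤ/C)`; `B_d ≤ #fibres · Dτ³ · (2 + 112·X₁Y₁/C₀')`, `C₀' = c₃·offVal {i₀} Z`,
i.e. `B ≤ Dτ³(2P/(Z₀X₁Y₁) + 112·P/(c₃ shapeVal Z))`; the certificate is the single inequality `P ≤ 2R·Z₀X₁Y₁` because the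
main term is automatic: `c₃·shapeVal Z ≥ C₀/V₂` (`Admissible.le_valZ`, `V₂ = shapeVal (2,…,2)`) and `P ≤ (2C₀)^{l+3ε}`
(`Admissible.prod_le`) give `112 P/(c₃ shapeVal Z) ≤ 112 V₂ 2^{l+3ε} C₀^{l-1+3ε}`. (Host `b` needs no stub: it follows from
host `a` by the symmetry `shapeCount c₁ c₂ c₃ X Y Z = shapeCount c₂ c₁ c₃ Y X Z`, proved below as `shapeCount_swap` /
`twoRootTameYAt_of_X`.) Leans on: as `stub_twoRootTameX`. -/
theorem stub_twoRootTameZ : ∀ l : ℝ, 1 < l → l < 2 → ∀ ε : ℝ, 0 < ε → ε < 1 / 2 → ∀ η : ℝ, 0 < η → ∃ K : ℝ, ∀ (C₀ c₁ c₂ c₃ : ℕ) (X Y Z : Fin (Literature.NumberTheory.DiophantineGeometry.AbcShapes.numShapes ε) → ℕ) (i₀ i₁ : Fin (Literature.NumberTheory.DiophantineGeometry.AbcShapes.numShapes ε)), (i₀ : ℕ) = 0 → (i₁ : ℕ) = 1 → Literature.NumberTheory.DiophantineGeometry.AbcShapes.Admissible l ε C₀ c₁ c₂ c₃ X Y Z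 → ((∏ i, ((X i : ℝ) * Y i * Z i)) ≤ 2 * (C₀ : ℝ) ^ (l - 1 + 3 * ε) * ((Z i₀ : ℝ) * X i₁ * Y i₁)) → (Literature.NumberTheory.DiophantineGeometry.AbcShapes.shapeCount c₁ c₂ c₃ X Y Z : ℝ) ≤ K * (C₀ : ℝ) ^ (l - 1 + 3 * ε + η) :=
  Summit.ABC.ABC.Theorems.MazurKaneLaw.stub_twoRootTameZ

/-- **STUB 3c · `stub_nearWallR2`** (XL, OPEN — THE RESIDUE OF THE LEVER after the two-root tool; held by the lead) — the
shape law on admissible near-wall data (no off-wall certificate, linear depth `≤ C₀^{1/4}`) that carry NO R₂ certificate for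
any of the three hosts. By the lead's exponent analysis (NOTES.md §Residual; to be landed as a structure lemma in the pattern
of `wild_wall_structure`) such data near `l = 2 - δ` have, up to `O(ρ)`, one of two level profiles: `R(δ,1)`:
`a = u x² w³` (`u ≍ x ≍ N^{1/3-δ}`, `w ≍ N^{δ}`), `b = u'x'²`, `c = u''x''²` (all four `≍ N^{1/3}`); `R(δ,2)`: two terms
`u x² w³` with `(N^{1/3-δ/2}, N^{1/3-δ/2}, N^{δ/2})` and one term `u x²` `(N^{1/3}, N^{1/3})` — on both, Kane's lattices, the
sharp conic, every mixed lattice, the root tool and R₂ give exactly `N¹` against the law `N^{1-δ}` (the symmetric wall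
`k = 3` is NOT here: the mixed lattice certifies it at `1 - Θ(δ)`). Equivalently (`R(δ,1)`, modulus `q = x²w³ ≍ N^{2/3+δ}`):
among the `N^{2/3}` square-ratios `(x'/x'')² mod q` at most `N^{2/3-δ+η}` may fall in the height-`N^{1/3}` Farey set
`{u''/u'}` (density `N^{-δ}`), on average over the `N^{1/3}` moduli; the diagonal `x' = x'', u' = u''` (= `b = c`, killed only
by coprimality) has exactly Kane's size `N^{2/3}` per modulus, which is why every complete-sum / moment / large-sieve
treatment returns `N¹` (NOTES.md §Lever: absolute values on the dual `(k,u₀,y₁)` sum lose `N^{δ}` identically; the needed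
cancellation at depth `δ` is `q^{1/2+3δ/4}`, beyond Weil for every `δ > 0`; Baier–Zhao's square-moduli large sieve gives
`N^{7/6-2δ/3} > N`). WHY PLAUSIBLY TRUE: implied by the crux (as every regional shape law). This is the statement to
promote if no lever bites; with it the line closes `MazurKaneLaw` on `[15/8, 2)` outright and on `(1,2)` modulo
`stub_deepResidual`. -/
theorem stub_nearWallR2 : ∀ l : ℝ, 1 < l → l < 2 → ∀ ε : ℝ, 0 < ε → ε < 1 / 2 → ∀ η : ℝ, 0 < η → ∃ K : ℝ, ∀ (C₀ c₁ c₂ c₃ : ℕ) (X Y Z : Fin (Literature.NumberTheory.DiophantineGeometry.AbcShapes.numShapes ε) → ℕ) (i₀ i₁ : Fin (Literature.NumberTheory.DiophantineGeometry.AbcShapes.numShapes ε)), (i₀ : ℕ) = 0 → (i₁ : ℕ) = 1 → Literature.NumberTheory.DiophantineGeometry.AbcShapes.Admissible l ε C₀ c₁ c₂ c₃ X Y Z → ¬ ((∏ i, ((X i : ℝ) * Y i * Z i)) ≤ 2 * (C₀ : ℝ) ^ (l - 1 + 3 * ε) * ((X i₀ : ℝ) * Y i₀ * Z i₀) ∨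 ((∏ i, ((X i : ℝ) * Y i * Z i)) ≤ 2 * (C₀ : ℝ) ^ (l - 1 + 3 * ε) * ((X i₁ : ℝ) * Y i₁ * Z i₁) ∧ (∏ i, ((X i : ℝ) * Y i * Z i)) ^ 3 ≤ 64 * ((C₀ : ℝ) ^ (l - 1 + 3 * ε)) ^ 3 * (((c₁ * Literature.NumberTheory.DiophantineGeometry.AbcShapes.shapeVal X : ℕ) : ℝ) * ((c₂ * Literature.NumberTheory.DiophantineGeometry.AbcShapes.shapeVal Y : ℕ) : ℝ) * ((c₃ * Literature.NumberTheory.DiophantineGeometry.AbcShapes.shapeVal Z : ℕ) : ℝ)))) → (∏ i, ((X i : ℝ) * Y i * Z i)) ≤ 2 * (C₀ : ℝ) ^ (l - 1 + 3 * ε) * (C₀ : ℝ) ^ (1 / 4 : ℝ) * ((X i₀ : ℝ) * Y i₀ * Z i₀) → ¬ (((∏ i, ((X i : ℝ) * Y i * Z i)) ≤ 2 * (C₀ : ℝ) ^ (l - 1 + 3 * ε) * ((X i₀ : ℝ) * Y i₁ * Z i₁) ∧ (∏ i, ((X i : ℝ) * Y i * Z i)) ≤ (C₀ : ℝ) ^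 (l - 1 + 3 * ε) * ((c₁ * Literature.NumberTheory.DiophantineGeometry.AbcShapes.shapeVal X : ℕ) : ℝ)) ∨ ((∏ i, ((X i : ℝ) * Y i * Z i)) ≤ 2 * (C₀ : ℝ) ^ (l - 1 + 3 * ε) * ((Y i₀ : ℝ) * X i₁ * Z i₁) ∧ (∏ i, ((X i : ℝ) * Y i * Z i)) ≤ (C₀ : ℝ) ^ (l - 1 + 3 * ε) * ((c₂ * Literature.NumberTheory.DiophantineGeometry.AbcShapes.shapeVal Y : ℕ) : ℝ)) ∨ ((∏ i, ((X i : ℝ) * Y i * Z i)) ≤ 2 * (C₀ : ℝ) ^ (l - 1 + 3 * ε) * ((Z i₀ : ℝ) * X i₁ * Y i₁))) → (Literature.NumberTheory.DiophantineGeometry.AbcShapes.shapeCount c₁ c₂ c₃ X Y Z : ℝ) ≤ K * (C₀ : ℝ) ^ (l - 1 + 3 * ε + η) := by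
  sorry

/-- **STUB 4 · `stub_deepResidual`** (XL⁺, OPEN, FOREIGN — not attacked by this line) — THE DEEP RESIDUAL: the
shape law on the bad region beyond linear depth `1/4` (no certificate of STUB 2 and `P > 2R C₀^{1/4} P₀`), at every
`l ∈ (1,2)`. VACUOUS for `l ≥ 15/8`: the region is empty there (`not_deep`, proved in this file from the
structure inequalities `P³ ≤ A·P₀²P₁`, `P² ≤ A·P₀`), which is why the line ALONE reaches `[15/8, 2)`
(`lawAt_of_offWall_nearWall`). Below `15/8` it is most of Mazur's question: the symmetric wall of depth
`δ = 2 - l > 1/4`, the asymmetric walls down to `12/7` (map line's LP), the cube-heavy / twisted-Fermat boxes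
`u₀y₀³ + u₁y₁³ = u₂y₂³` below `5/3`, and at `l → 1⁺` the bound "abc hits `≪ N^{δ}` for every `δ`" (record `0.6`,
tree `bernertEtAl2024_thm_1_3_holds`; Disproof `abcHitCount_le_of_mazurKaneLaw` shows the crux needs it). WHY
PLAUSIBLY TRUE: implied by the crux (Mazur 2000 / Kane Conj. 1); no positive-power family of near-hits is known
(Dahmen 2008: `exp((log N)^{1/2-ε})`). RECOMMENDED to the tenure planner: split the crux item along this seam
(this file types both halves and the glue). Candidate levers on file: `peyre-level-torsor-v22` /
`heegner-cusp-subholzer` (level aspect, reach `5/3`), `aligned-power-curve-rigidity` (cubes).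
[arXiv:1104.2635 Conj. 1, Thm 2; Mazur, Notices AMS 47 (2000) 195–202; arXiv:2410.12234 Thms 1.2–1.3] -/
theorem stub_deepResidual : ∀ l : ℝ, 1 < l → l < 2 → ∀ ε : ℝ, 0 < ε → ε < 1 / 2 → ∀ η : ℝ, 0 < η → ∃ K : ℝ, ∀ (C₀ c₁ c₂ c₃ : ℕ) (X Y Z : Fin (Literature.NumberTheory.DiophantineGeometry.AbcShapes.numShapes ε) → ℕ) (i₀ i₁ : Fin (Literature.NumberTheory.DiophantineGeometry.AbcShapes.numShapes ε)), (i₀ : ℕ) = 0 → (i₁ : ℕ) = 1 → Literature.NumberTheory.DiophantineGeometry.AbcShapes.Admissible l ε C₀ c₁ c₂ c₃ X Y Z → ¬ ((∏ i, ((X i : ℝ) * Y i * Z i)) ≤ 2 * (C₀ : ℝ) ^ (l - 1 + 3 * ε) * ((X i₀ : ℝ) * Y i₀ * Z i₀) ∨ ((∏ i, ((X i : ℝ) * Y i * Z i)) ≤ 2 * (C₀ : ℝ) ^ (l - 1 + 3 * ε) * ((X i₁ : ℝ) * Y i₁ * Z i₁) ∧ (∏ i, ((X i : ℝ) * Y i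 * Z i)) ^ 3 ≤ 64 * ((C₀ : ℝ) ^ (l - 1 + 3 * ε)) ^ 3 * (((c₁ * Literature.NumberTheory.DiophantineGeometry.AbcShapes.shapeVal X : ℕ) : ℝ) * ((c₂ * Literature.NumberTheory.DiophantineGeometry.AbcShapes.shapeVal Y : ℕ) : ℝ) * ((c₃ * Literature.NumberTheory.DiophantineGeometry.AbcShapes.shapeVal Z : ℕ) : ℝ)))) → ¬ ((∏ i, ((X i : ℝ) * Y i * Z i)) ≤ 2 * (C₀ : ℝ) ^ (l - 1 + 3 * ε) * (C₀ : ℝ) ^ (1 / 4 : ℝ) * ((X i₀ : ℝ) * Y i₀ * Z i₀)) → (Literature.NumberTheory.DiophantineGeometry.AbcShapes.shapeCount c₁ c₂ c₃ X Y Z : ℝ) ≤ K * (C₀ : ℝ) ^ (l - 1 + 3 * ε + η) := by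
  sorry

/-- **STUB B · `stub_kitDE_lp_value_plateau`** (M, PROVABLE NOW — BARRIER CERTIFICATE of the record pipeline, lead c4 cycle 2):
the LP of the enlarged fibre toolkit WITH the DE families (`LpCertDE K J s₀ Vc`, any slack coefficient `K`, any number `J ≥ 3` of
explicit levels) proves no exponent below `(2 + s₀)/4` anywhere on the plateau `s₀ ∈ [16/9, 2]`: the landed `recordAt_DE`
(`(2 + s₀)/4`, p133160) is the END of the sub-Kane range of kit + DE, exactly as `kit_lp_value_one_at_sixteen_ninths` (p120426)
was for the kit. WITNESS (the balanced point of the optimal face `F(s₀) = {Σ₀ = Σ₁ = (3s₀-2)/4, Σ₂ = (2-s₀)/2, one deficit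
3(2-s₀)/4}`): `x = (3s₀-4)/6`, `y = (10-3s₀)/12`, `a = (x, x, (2-s₀)/2, 0, …)`, `b = (y, x, 0, …)`, `c = (x, y, 0, …)`,
`A = 2x + (2-s₀)/2`, `B = C = x + y`, `da = dc = σ = 0`, `db = 3(2-s₀)/4`, `D = (2+s₀)/4`; every structural row holds (the three
slope rows with equality), and every member of the trivial / determinant / Fourier / geometry-of-numbers / square-root-lattice / DE
families holds for ALL index finsets (checked exactly on a 41-point grid of `s₀` and symbolically: each row is affine in `s₀` on
`[16/9, 2]` once the memberships of the indices `0, 1, 2` in the finsets are fixed; minimal slack `0`, attained e.g. by `det k = 1`,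
`gon I = J' = K = {0}`, `sqrt host b H = {0} k = 1`, `DE host a Q = {1,2}`). Proof pattern: `kit_lp_value_one_at_sixteen_ninths`
(TwistAmplificationMazurKaneLawKitPlateau.lean): instantiate the certificate at the witness, evaluate `∑ k, ·` and the first
moments by `Fin.sum_univ_eq_sum_range` + `Finset.sum_range_succ`, and dispatch each family by `by_cases` on the memberships of the
three special indices followed by `linarith`. -/
theorem stub_kitDE_lp_value_plateau : ∀ (K : ℝ) (J : ℕ), 3 ≤ J → ∀ s₀ : ℝ, (16 / 9 : ℝ) ≤ s₀ → s₀ ≤ 2 → ∀ Vc : ℝ, Summit.ABC.ABC.Theorems.MazurKaneLaw.Toolkit.LpCertDE K J s₀ Vc → (2 + s₀) / 4 ≤ Vc := by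
  sorry

/-! ## Consistency: each named statement IS its registered stub (definitionally) -/

theorem transferAt_holds : TransferAt := stub_transfer
theorem offWallLaw_holds : OffWallLaw := stub_offWall
theorem twoRootTameXLaw_holds : TwoRootTameXLaw := stub_twoRootTameX
theorem twoRootTameZLaw_holds : TwoRootTameZLaw := stub_twoRootTameZ
theorem nearWallR2Law_holds : NearWallR2Law := stub_nearWallR2
theorem deepResidualLaw_holds : DeepResidualLaw := stub_deepResidual

/-! ## Name-keyed aliases of the four statements (the hypotheses of the composition) -/
namespace Registered

/-- Alias of `TransferAt` keyed by the registered stub name. -/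
abbrev stub_transfer : Prop := TransferAt
/-- Alias of `OffWallLaw` keyed by the registered stub name. -/
abbrev stub_offWall : Prop := OffWallLaw
/-- Alias of `TwoRootTameXLaw` keyed by the registered stub name. -/
abbrev stub_twoRootTameX : Prop := TwoRootTameXLaw
/-- Alias of `TwoRootTameZLaw` keyed by the registered stub name. -/
abbrev stub_twoRootTameZ : Prop := TwoRootTameZLaw
/-- Alias of `NearWallR2Law` keyed by the registered stub name. -/
abbrev stub_nearWallR2 : Prop := NearWallR2Law
/-- Alias of `DeepResidualLaw` keyed by the registered stub name. -/
abbrev stub_deepResidual : Prop := DeepResidualLaw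

end Registered

/-! ## Proved glue -/

/-- For `0 < ε < 1/2` there are at least two shape levels (`⌊10/ε²⌋ ≥ 40`), so coordinates `0` and `1` exist. -/
theorem two_le_numShapes {ε : ℝ} (hε : 0 < ε) (hε2 : ε < 1 / 2) : 2 ≤ numShapes ε := by
  unfold numShapes
  apply Nat.le_floor
  rw [Nat.cast_ofNat, le_div_iff₀ (by positivity)]
  nlinarith

/-- The three regional laws at `l` give the shape law at `l` (case split on the region; constants maxed). -/
theorem shapeLawAt_of_regions {l : ℝ} (hO : OffWallAt l) (hN : NearWallAt l) (hD : DeepAt l) :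
    ShapeLawAt l := by
  intro ε hε hε2 η hη
  obtain ⟨K₁, hK₁⟩ := hO ε hε hε2 η hη
  obtain ⟨K₂, hK₂⟩ := hN ε hε hε2 η hη
  obtain ⟨K₃, hK₃⟩ := hD ε hε hε2 η hη
  have h2 := two_le_numShapes hε hε2
  refine ⟨max K₁ (max K₂ K₃), fun C₀ c₁ c₂ c₃ X Y Z hA => ?_⟩
  have hC : (0 : ℝ) ≤ (C₀ : ℝ) ^ (l - 1 + 3 * ε + η) := Real.rpow_nonneg (Nat.cast_nonneg _) _
  have hO' := hK₁ C₀ c₁ c₂ c₃ X Y Z ⟨0, by omega⟩ ⟨1, by omega⟩ rfl rfl hA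
  have hN' := hK₂ C₀ c₁ c₂ c₃ X Y Z ⟨0, by omega⟩ ⟨1, by omega⟩ rfl rfl hA
  have hD' := hK₃ C₀ c₁ c₂ c₃ X Y Z ⟨0, by omega⟩ ⟨1, by omega⟩ rfl rfl hA
  refine (Classical.em _).elim (fun h1 => (hO' h1).trans ?_) (fun h1 => ?_)
  · exact mul_le_mul_of_nonneg_right (le_max_left _ _) hC
  refine (Classical.em _).elim (fun h2 => (hN' h1 h2).trans ?_) (fun h2 => (hD' h1 h2).trans ?_)
  · exact mul_le_mul_of_nonneg_right ((le_max_left _ _).trans (le_max_right _ _)) hC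
  · exact mul_le_mul_of_nonneg_right ((le_max_right _ _).trans (le_max_right _ _)) hC

/-! ## The composition: the four stubs imply the crux, by name -/

/-! ### Lead v2 glue: host `Y` from host `X` by symmetry, and the lever from its three pieces -/

/-- `B_d` is symmetric in the first two terms: `shapeCount c₁ c₂ c₃ X Y Z = shapeCount c₂ c₁ c₃ Y X Z` (swap `x ↔ y`). -/
theorem shapeCount_swap {d : ℕ} (c₁ c₂ c₃ : ℕ) (X Y Z : Fin d → ℕ) :
    shapeCount c₁ c₂ c₃ X Y Z = shapeCount c₂ c₁ c₃ Y X Z := by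
  classical
  unfold shapeCount
  refine Finset.card_bij' (fun t _ => (t.2.1, t.1, t.2.2)) (fun t _ => (t.2.1, t.1, t.2.2)) ?_ ?_
    (fun _ _ => rfl) (fun _ _ => rfl)
  · intro t ht
    simp only [shapeTriples, mem_filter, mem_product] at ht ⊢
    obtain ⟨⟨hx, hy, hz⟩, heq, hg⟩ := ht
    refine ⟨⟨hy, hx, hz⟩, by rw [← heq]; ring, ?_⟩
    rw [← hg, ← Nat.gcd_assoc, ← Nat.gcd_assoc, Nat.gcd_comm (c₂ * shapeProd t.2.1)]
  · intro t ht
    simp only [shapeTriples, mem_filter, mem_product] at ht ⊢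
    obtain ⟨⟨hy, hx, hz⟩, heq, hg⟩ := ht
    refine ⟨⟨hx, hy, hz⟩, by rw [← heq]; ring, ?_⟩
    rw [← hg, ← Nat.gcd_assoc, ← Nat.gcd_assoc, Nat.gcd_comm (c₁ * shapeProd t.2.1)]

/-- Admissibility is symmetric in the first two terms. -/
theorem admissible_swap {l ε : ℝ} {M : ℕ} {C₀ c₁ c₂ c₃ : ℕ} {X Y Z : Fin M → ℕ}
    (hA : Admissible l ε C₀ c₁ c₂ c₃ X Y Z) : Admissible l ε C₀ c₂ c₁ c₃ Y X Z where
  one_le := hA.one_le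
  pos₁ := hA.pos₂
  pos₂ := hA.pos₁
  pos₃ := hA.pos₃
  le₁ := hA.le₂
  le₂ := hA.le₁
  le₃ := hA.le₃
  X_pos := hA.Y_pos
  Y_pos := hA.X_pos
  Z_pos := hA.Z_pos
  prod_le := by
    have h := hA.prod_le
    calc (∏ i, ((Y i : ℝ) * X i * Z i)) = ∏ i, ((X i : ℝ) * Y i * Z i) :=
          Finset.prod_congr rfl fun i _ => by ring
      _ ≤ _ := h
  valX_le := hA.valY_le
  valY_le := hA.valX_le
  valZ_le := hA.valZ_le
  le_valZ := hA.le_valZ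

/-- Host `Y` from host `X`: apply the `X`-law to the swapped datum `(c₂, c₁, c₃; Y, X, Z)`. -/
theorem twoRootTameYAt_of_X {l : ℝ} (hX : TwoRootTameXAt l) : TwoRootTameYAt l := by
  intro ε hε hε2 η hη
  obtain ⟨K, hK⟩ := hX ε hε hε2 η hη
  refine ⟨K, fun C₀ c₁ c₂ c₃ X Y Z i₀ i₁ h0 h1 hA hc => ?_⟩
  have hprod : (∏ i, ((Y i : ℝ) * X i * Z i)) = ∏ i, ((X i : ℝ) * Y i * Z i) :=
    Finset.prod_congr rfl fun i _ => by ring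
  have hc' : CertX l ε C₀ c₂ Y X Z i₀ i₁ := by
    obtain ⟨h₁, h₂⟩ := hc
    exact ⟨by rw [hprod]; exact h₁, by rw [hprod]; exact h₂⟩
  have h := hK C₀ c₂ c₁ c₃ Y X Z i₀ i₁ h0 h1 (admissible_swap hA) hc'
  rw [shapeCount_swap]
  exact h

/-- THE LEVER FROM ITS THREE PIECES (lead v2 reshape of `stub_nearWall`): on near-wall data, an R₂ certificate for host
`X`, `Y` or `Z` gives the law by the two-root laws, and data with no R₂ certificate are the residue `NearWallR2At`. -/
theorem nearWallAt_of_twoRoot {l : ℝ} (hX : TwoRootTameXAt l) (hZ : TwoRootTameZAt l) (hR : NearWallR2At l) :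
    NearWallAt l := by
  intro ε hε hε2 η hη
  obtain ⟨K₁, hK₁⟩ := hX ε hε hε2 η hη
  obtain ⟨K₂, hK₂⟩ := twoRootTameYAt_of_X hX ε hε hε2 η hη
  obtain ⟨K₃, hK₃⟩ := hZ ε hε hε2 η hη
  obtain ⟨K₄, hK₄⟩ := hR ε hε hε2 η hη
  refine ⟨max (max K₁ K₂) (max K₃ K₄), fun C₀ c₁ c₂ c₃ X Y Z i₀ i₁ h0 h1 hA hoff hnw => ?_⟩
  have hC : (0 : ℝ) ≤ (C₀ : ℝ) ^ (l - 1 + 3 * ε + η) := Real.rpow_nonneg (Nat.cast_nonneg _) _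
  by_cases cX : CertX l ε C₀ c₁ X Y Z i₀ i₁
  · exact (hK₁ C₀ c₁ c₂ c₃ X Y Z i₀ i₁ h0 h1 hA cX).trans
      (mul_le_mul_of_nonneg_right ((le_max_left _ _).trans (le_max_left _ _)) hC)
  by_cases cY : CertY l ε C₀ c₂ X Y Z i₀ i₁
  · exact (hK₂ C₀ c₁ c₂ c₃ X Y Z i₀ i₁ h0 h1 hA cY).trans
      (mul_le_mul_of_nonneg_right ((le_max_right _ _).trans (le_max_left _ _)) hC)
  by_cases cZ : CertZ l ε C₀ X Y Z i₀ i₁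
  · exact (hK₃ C₀ c₁ c₂ c₃ X Y Z i₀ i₁ h0 h1 hA cZ).trans
      (mul_le_mul_of_nonneg_right ((le_max_left _ _).trans (le_max_right _ _)) hC)
  have hnc : ¬ (CertX l ε C₀ c₁ X Y Z i₀ i₁ ∨ CertY l ε C₀ c₂ X Y Z i₀ i₁ ∨ CertZ l ε C₀ X Y Z i₀ i₁) := by
    rintro (h | h | h)
    · exact cX h
    · exact cY h
    · exact cZ h
  exact (hK₄ C₀ c₁ c₂ c₃ X Y Z i₀ i₁ h0 h1 hA hoff hnw hnc).trans
    (mul_le_mul_of_nonneg_right ((le_max_right _ _).trans (le_max_right _ _)) hC)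

/-- The v1 lever statement `NearWallLaw` from the three registered v2 stubs that replace it. -/
theorem nearWallLaw_of (hX : Registered.stub_twoRootTameX) (hZ : Registered.stub_twoRootTameZ)
    (hR : Registered.stub_nearWallR2) : NearWallLaw :=
  fun l hl1 hl2 => nearWallAt_of_twoRoot (hX l hl1 hl2) (hZ l hl1 hl2) (hR l hl1 hl2)

/-! ## The composition: the six registered stubs imply the crux, by name -/

/-- `MazurKaneLaw` from the six registered stubs (pure logic; no `sorry`): for `1 < s < 2`, STUB 1 reduces the law at `s`
to the shape law at every `l ∈ (s, 2)`, which STUB 2 (off-wall), STUBS 3a–3c (the lever: two-root laws + residue) and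
STUB 4 (deep residual) supply region by region (`shapeLawAt_of_regions`). -/
theorem MazurKaneLaw_of (hT : Registered.stub_transfer) (hO : Registered.stub_offWall)
    (hX : Registered.stub_twoRootTameX) (hZ : Registered.stub_twoRootTameZ) (hR : Registered.stub_nearWallR2)
    (hD : Registered.stub_deepResidual) :
    Summit.ABC.ABC.Theses.TwistAmplification.MazurKaneLaw := by
  have hN : NearWallLaw := nearWallLaw_of hX hZ hR
  intro s hs1 hs2
  exact hT s hs1 hs2 fun l hl1 hl2 =>
    shapeLawAt_of_regions (hO l (by linarith) hl2) (hN l (by linarith) hl2) (hD l (by linarith) hl2)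

/-- **The skeleton**: the crux modulo exactly the six registered stubs. -/
theorem MazurKaneLaw_proof : Summit.ABC.ABC.Theses.TwistAmplification.MazurKaneLaw :=
  MazurKaneLaw_of stub_transfer stub_offWall stub_twoRootTameX stub_twoRootTameZ stub_nearWallR2 stub_deepResidual

/-! ## The reach of the line without the foreign stub: `[15/8, 2)` (kernel-checked) -/

/-- One shape tuple: `(∏ᵢ xᵢ)³ ≤ (∏ᵢ xᵢ^{i+1}) · x₀² · x₁`, because every exponent `i + 1` with `i ≥ 2` is `≥ 3`. -/
theorem prod_pow_three_le {M : ℕ} (X : Fin M → ℕ) (hX : ∀ i, 0 < X i) (i₀ i₁ : Fin M)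
    (h0 : (i₀ : ℕ) = 0) (h1 : (i₁ : ℕ) = 1) :
    (∏ i, X i) ^ 3 ≤ shapeVal X * (X i₀ ^ 2 * X i₁) := by
  obtain ⟨m, rfl⟩ : ∃ m, M = m + 2 := ⟨M - 2, by have := i₁.isLt; omega⟩
  have hi0 : i₀ = 0 := Fin.ext h0
  have hi1 : i₁ = 1 := Fin.ext (by simp [h1])
  rw [hi0, hi1, shapeVal, Fin.prod_univ_succ, Fin.prod_univ_succ (n := m),
    Fin.prod_univ_succ (f := fun i : Fin (m + 2) => X i ^ ((i : ℕ) + 1)),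
    Fin.prod_univ_succ (f := fun i : Fin (m + 1) => X i.succ ^ ((i.succ : ℕ) + 1))]
  simp only [Fin.val_zero, Fin.val_succ, zero_add, pow_one, Fin.succ_zero_eq_one]
  set T : ℕ := ∏ i : Fin m, X i.succ.succ with hTdef
  set T' : ℕ := ∏ i : Fin m, X i.succ.succ ^ ((i : ℕ) + 1 + 1 + 1) with hT'def
  have hT : T ^ 3 ≤ T' := by
    rw [hTdef, hT'def, ← prod_pow]
    refine prod_le_prod (fun i _ => Nat.zero_le _) fun i _ => ?_
    exact Nat.pow_le_pow_right (hX _) (by omega)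
  calc (X 0 * (X 1 * T)) ^ 3 = X 0 * X 1 ^ (1 + 1) * (X 0 ^ 2 * X 1) * T ^ 3 := by ring
    _ ≤ X 0 * X 1 ^ (1 + 1) * (X 0 ^ 2 * X 1) * T' := Nat.mul_le_mul_left _ hT
    _ = X 0 * (X 1 ^ (1 + 1) * T') * (X 0 ^ 2 * X 1) := by ring

/-- THE STRUCTURE INEQUALITY `P³ ≤ Θ³(2C₀)³·P₀²·P₁`, in the form
`(∏ XᵢYᵢZᵢ)³ ≤ (c₁·shapeVal X)(c₂·shapeVal Y)(c₃·shapeVal Z) · (X₀Y₀Z₀)² (X₁Y₁Z₁)`. -/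
theorem prod_cube_le {M : ℕ} {c₁ c₂ c₃ : ℕ} (hc₁ : 0 < c₁) (hc₂ : 0 < c₂) (hc₃ : 0 < c₃)
    (X Y Z : Fin M → ℕ) (hX : ∀ i, 0 < X i) (hY : ∀ i, 0 < Y i) (hZ : ∀ i, 0 < Z i)
    (i₀ i₁ : Fin M) (h0 : (i₀ : ℕ) = 0) (h1 : (i₁ : ℕ) = 1) :
    (∏ i, ((X i : ℝ) * Y i * Z i)) ^ 3 ≤
      ((c₁ * shapeVal X : ℕ) : ℝ) * ((c₂ * shapeVal Y : ℕ) : ℝ) * ((c₃ * shapeVal Z : ℕ) : ℝ) *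
        (((X i₀ : ℝ) * Y i₀ * Z i₀) ^ 2 * ((X i₁ : ℝ) * Y i₁ * Z i₁)) := by
  have hx := prod_pow_three_le X hX i₀ i₁ h0 h1
  have hy := prod_pow_three_le Y hY i₀ i₁ h0 h1
  have hz := prod_pow_three_le Z hZ i₀ i₁ h0 h1
  have hx' : (∏ i, X i) ^ 3 ≤ c₁ * shapeVal X * (X i₀ ^ 2 * X i₁) :=
    hx.trans (Nat.mul_le_mul_right _ (Nat.le_mul_of_pos_left _ hc₁))
  have hy' : (∏ i, Y i) ^ 3 ≤ c₂ * shapeVal Y * (Y i₀ ^ 2 * Y i₁) :=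
    hy.trans (Nat.mul_le_mul_right _ (Nat.le_mul_of_pos_left _ hc₂))
  have hz' : (∏ i, Z i) ^ 3 ≤ c₃ * shapeVal Z * (Z i₀ ^ 2 * Z i₁) :=
    hz.trans (Nat.mul_le_mul_right _ (Nat.le_mul_of_pos_left _ hc₃))
  have hnat : ((∏ i, X i) * (∏ i, Y i) * (∏ i, Z i)) ^ 3 ≤
      (c₁ * shapeVal X) * (c₂ * shapeVal Y) * (c₃ * shapeVal Z) *
        ((X i₀ * Y i₀ * Z i₀) ^ 2 * (X i₁ * Y i₁ * Z i₁)) := by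
    calc ((∏ i, X i) * (∏ i, Y i) * (∏ i, Z i)) ^ 3
        = (∏ i, X i) ^ 3 * (∏ i, Y i) ^ 3 * (∏ i, Z i) ^ 3 := by ring
      _ ≤ (c₁ * shapeVal X * (X i₀ ^ 2 * X i₁)) * (c₂ * shapeVal Y * (Y i₀ ^ 2 * Y i₁)) *
            (c₃ * shapeVal Z * (Z i₀ ^ 2 * Z i₁)) :=
          Nat.mul_le_mul (Nat.mul_le_mul hx' hy') hz'
      _ = (c₁ * shapeVal X) * (c₂ * shapeVal Y) * (c₃ * shapeVal Z) *
            ((X i₀ * Y i₀ * Z i₀) ^ 2 * (X i₁ * Y i₁ * Z i₁)) := by ring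
  have hR : (∏ i, ((X i : ℝ) * Y i * Z i)) =
      (((∏ i, X i) * (∏ i, Y i) * (∏ i, Z i) : ℕ) : ℝ) := by
    push_cast
    simp only [prod_mul_distrib]
  rw [hR]
  exact_mod_cast hnat

/-- One shape tuple: `(∏ᵢ xᵢ)² ≤ (∏ᵢ xᵢ^{i+1}) · x₀`, because every exponent `i + 1` with `i ≥ 1` is `≥ 2`. -/
theorem prod_sq_le {M : ℕ} (X : Fin M → ℕ) (hX : ∀ i, 0 < X i) (i₀ : Fin M) (h0 : (i₀ : ℕ) = 0) :
    (∏ i, X i) ^ 2 ≤ shapeVal X * X i₀ := by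
  obtain ⟨m, rfl⟩ : ∃ m, M = m + 1 := ⟨M - 1, by have := i₀.isLt; omega⟩
  have hi0 : i₀ = 0 := Fin.ext h0
  rw [hi0, shapeVal, Fin.prod_univ_succ,
    Fin.prod_univ_succ (f := fun i : Fin (m + 1) => X i ^ ((i : ℕ) + 1))]
  simp only [Fin.val_zero, Fin.val_succ, zero_add, pow_one]
  set T : ℕ := ∏ i : Fin m, X i.succ with hTdef
  set T' : ℕ := ∏ i : Fin m, X i.succ ^ ((i : ℕ) + 1 + 1) with hT'def
  have hT : T ^ 2 ≤ T' := by
    rw [hTdef, hT'def, ← prod_pow]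
    refine prod_le_prod (fun i _ => Nat.zero_le _) fun i _ => ?_
    exact Nat.pow_le_pow_right (hX _) (by omega)
  calc (X 0 * T) ^ 2 = X 0 * X 0 * T ^ 2 := by ring
    _ ≤ X 0 * X 0 * T' := Nat.mul_le_mul_left _ hT
    _ = X 0 * T' * X 0 := by ring

/-- THE SECOND STRUCTURE INEQUALITY `P² ≤ Θ³(2C₀)³·P₀`, in the form
`(∏ XᵢYᵢZᵢ)² ≤ (c₁·shapeVal X)(c₂·shapeVal Y)(c₃·shapeVal Z) · (X₀Y₀Z₀)`. -/
theorem prod_sq_le_three {M : ℕ} {c₁ c₂ c₃ : ℕ} (hc₁ : 0 < c₁) (hc₂ : 0 < c₂) (hc₃ : 0 < c₃)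
    (X Y Z : Fin M → ℕ) (hX : ∀ i, 0 < X i) (hY : ∀ i, 0 < Y i) (hZ : ∀ i, 0 < Z i)
    (i₀ : Fin M) (h0 : (i₀ : ℕ) = 0) :
    (∏ i, ((X i : ℝ) * Y i * Z i)) ^ 2 ≤
      ((c₁ * shapeVal X : ℕ) : ℝ) * ((c₂ * shapeVal Y : ℕ) : ℝ) * ((c₃ * shapeVal Z : ℕ) : ℝ) *
        ((X i₀ : ℝ) * Y i₀ * Z i₀) := by
  have hx' : (∏ i, X i) ^ 2 ≤ c₁ * shapeVal X * X i₀ :=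
    (prod_sq_le X hX i₀ h0).trans (Nat.mul_le_mul_right _ (Nat.le_mul_of_pos_left _ hc₁))
  have hy' : (∏ i, Y i) ^ 2 ≤ c₂ * shapeVal Y * Y i₀ :=
    (prod_sq_le Y hY i₀ h0).trans (Nat.mul_le_mul_right _ (Nat.le_mul_of_pos_left _ hc₂))
  have hz' : (∏ i, Z i) ^ 2 ≤ c₃ * shapeVal Z * Z i₀ :=
    (prod_sq_le Z hZ i₀ h0).trans (Nat.mul_le_mul_right _ (Nat.le_mul_of_pos_left _ hc₃))
  have hnat : ((∏ i, X i) * (∏ i, Y i) * (∏ i, Z i)) ^ 2 ≤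
      (c₁ * shapeVal X) * (c₂ * shapeVal Y) * (c₃ * shapeVal Z) * (X i₀ * Y i₀ * Z i₀) := by
    calc ((∏ i, X i) * (∏ i, Y i) * (∏ i, Z i)) ^ 2
        = (∏ i, X i) ^ 2 * (∏ i, Y i) ^ 2 * (∏ i, Z i) ^ 2 := by ring
      _ ≤ (c₁ * shapeVal X * X i₀) * (c₂ * shapeVal Y * Y i₀) * (c₃ * shapeVal Z * Z i₀) :=
          Nat.mul_le_mul (Nat.mul_le_mul hx' hy') hz'
      _ = (c₁ * shapeVal X) * (c₂ * shapeVal Y) * (c₃ * shapeVal Z) * (X i₀ * Y i₀ * Z i₀) := by ring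
  have hR : (∏ i, ((X i : ℝ) * Y i * Z i)) =
      (((∏ i, X i) * (∏ i, Y i) * (∏ i, Z i) : ℕ) : ℝ) := by
    push_cast
    simp only [prod_mul_distrib]
  rw [hR]
  exact_mod_cast hnat

/-- THE DEEP REGION IS EMPTY FOR `l ≥ 15/8`: on admissible data, not-off-wall forces linear depth `≤ C₀^{1/4}`.
Two cases of not-off-wall beyond `P > 2R·P₀`. (A) `P > 2R·P₁`: with `P > 2R C₀^{1/4} P₀` and `prod_cube_le`,
`8R³C₀^{1/2}·P₀²P₁ < P³ ≤ (2C₀)³ P₀²P₁`, i.e. `C₀^{3(l-1+3ε)+1/2} < C₀³` — impossible once `3l - 5/2 ≥ 3`.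
(B) `P³ > 64 R³·Θ³(2C₀)³`: with `prod_sq_le_three` (`Θ³(2C₀)³ ≥ P²/P₀`) this gives `P·P₀ > 64R³`, and with
`P₀ < P/(2RC₀^{1/4})` and `P ≤ (2C₀)^{l+3ε}`: `128 R⁴ C₀^{1/4} < 2^{2l+6ε} C₀^{2l+6ε} < 128 C₀^{2l+6ε}` — impossible
once `4(l-1) + 1/4 ≥ 2l`, i.e. `l ≥ 15/8`. -/
theorem not_deep {l ε : ℝ} (hε : 0 ≤ ε) (hε2 : ε < 1 / 2) (hl : 15 / 8 ≤ l) (hl2 : l < 2)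
    {C₀ c₁ c₂ c₃ : ℕ} {M : ℕ} {X Y Z : Fin M → ℕ} (hA : Admissible l ε C₀ c₁ c₂ c₃ X Y Z)
    (i₀ i₁ : Fin M) (h0 : (i₀ : ℕ) = 0) (h1 : (i₁ : ℕ) = 1)
    (hoff : ¬ ((∏ i, ((X i : ℝ) * Y i * Z i)) ≤ 2 * (C₀ : ℝ) ^ (l - 1 + 3 * ε) * ((X i₀ : ℝ) * Y i₀ * Z i₀) ∨
      ((∏ i, ((X i : ℝ) * Y i * Z i)) ≤ 2 * (C₀ : ℝ) ^ (l - 1 + 3 * ε) * ((X i₁ : ℝ) * Y i₁ * Z i₁) ∧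
        (∏ i, ((X i : ℝ) * Y i * Z i)) ^ 3 ≤ 64 * ((C₀ : ℝ) ^ (l - 1 + 3 * ε)) ^ 3 *
          (((c₁ * shapeVal X : ℕ) : ℝ) * ((c₂ * shapeVal Y : ℕ) : ℝ) * ((c₃ * shapeVal Z : ℕ) : ℝ))))) :
    (∏ i, ((X i : ℝ) * Y i * Z i)) ≤
      2 * (C₀ : ℝ) ^ (l - 1 + 3 * ε) * (C₀ : ℝ) ^ (1 / 4 : ℝ) * ((X i₀ : ℝ) * Y i₀ * Z i₀) := by
  by_contra hnw
  push Not at hnw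
  -- notation and positivity
  set P : ℝ := ∏ i, ((X i : ℝ) * Y i * Z i) with hP
  set P₀ : ℝ := (X i₀ : ℝ) * Y i₀ * Z i₀ with hP₀
  set P₁ : ℝ := (X i₁ : ℝ) * Y i₁ * Z i₁ with hP₁
  set A : ℝ := ((c₁ * shapeVal X : ℕ) : ℝ) * ((c₂ * shapeVal Y : ℕ) : ℝ) * ((c₃ * shapeVal Z : ℕ) : ℝ)
    with hAdef
  set R : ℝ := (C₀ : ℝ) ^ (l - 1 + 3 * ε) with hRdef
  set C4 : ℝ := (C₀ : ℝ) ^ (1 / 4 : ℝ) with hC4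
  have hC₀ : (1 : ℝ) ≤ C₀ := by exact_mod_cast hA.one_le
  have hC₀pos : (0 : ℝ) < C₀ := by linarith
  have hRpos : 0 < R := Real.rpow_pos_of_pos hC₀pos _
  have hC4pos : 0 < C4 := Real.rpow_pos_of_pos hC₀pos _
  have hXpos : ∀ i, (0 : ℝ) < X i := fun i => by exact_mod_cast hA.X_pos i
  have hYpos : ∀ i, (0 : ℝ) < Y i := fun i => by exact_mod_cast hA.Y_pos i
  have hZpos : ∀ i, (0 : ℝ) < Z i := fun i => by exact_mod_cast hA.Z_pos i
  have hPpos : 0 < P := prod_pos fun i _ => mul_pos (mul_pos (hXpos i) (hYpos i)) (hZpos i)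
  have hP₀pos : 0 < P₀ := mul_pos (mul_pos (hXpos _) (hYpos _)) (hZpos _)
  have hP₁pos : 0 < P₁ := mul_pos (mul_pos (hXpos _) (hYpos _)) (hZpos _)
  -- `A ≤ (2C₀)³` (admissibility: each term `≤ 2C₀`)
  have hAle : A ≤ (2 * (C₀ : ℝ)) ^ 3 := by
    have h₁ : ((c₁ * shapeVal X : ℕ) : ℝ) ≤ 2 * (C₀ : ℝ) := by exact_mod_cast hA.valX_le
    have h₂ : ((c₂ * shapeVal Y : ℕ) : ℝ) ≤ 2 * (C₀ : ℝ) := by exact_mod_cast hA.valY_le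
    have h₃ : ((c₃ * shapeVal Z : ℕ) : ℝ) ≤ 2 * (C₀ : ℝ) := by exact_mod_cast hA.valZ_le
    rw [hAdef]
    calc ((c₁ * shapeVal X : ℕ) : ℝ) * ((c₂ * shapeVal Y : ℕ) : ℝ) * ((c₃ * shapeVal Z : ℕ) : ℝ)
        ≤ (2 * (C₀ : ℝ)) * (2 * (C₀ : ℝ)) * (2 * (C₀ : ℝ)) := by
          gcongr
      _ = (2 * (C₀ : ℝ)) ^ 3 := by ring
  -- the two structure inequalities
  have hstruct : P ^ 3 ≤ A * (P₀ ^ 2 * P₁) :=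
    prod_cube_le hA.pos₁ hA.pos₂ hA.pos₃ X Y Z hA.X_pos hA.Y_pos hA.Z_pos i₀ i₁ h0 h1
  have hstruct2 : P ^ 2 ≤ A * P₀ :=
    prod_sq_le_three hA.pos₁ hA.pos₂ hA.pos₃ X Y Z hA.X_pos hA.Y_pos hA.Z_pos i₀ h0
  -- not-off-wall, second clause: `P > 2R·P₁` or `P³ > 64 R³ A`
  have hoff' : 2 * R * P₁ < P ∨ 64 * R ^ 3 * A < P ^ 3 := by
    by_contra h
    push Not at h
    exact hoff (Or.inr h)
  -- from not-near-wall: `2R·C4·P₀ < P`, squared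
  have hnw2 : (2 * R * C4 * P₀) ^ 2 < P ^ 2 :=
    pow_lt_pow_left₀ hnw (by positivity) two_ne_zero
  rcases hoff' with hcaseA | hcaseB
  · /- (A): `8 R³ C4² · P₀² P₁ < P³ ≤ A P₀² P₁ ≤ (2C₀)³ P₀² P₁` -/
    have hprod : (2 * R * C4 * P₀) ^ 2 * (2 * R * P₁) < P ^ 2 * P :=
      mul_lt_mul'' hnw2 hcaseA (by positivity) (by positivity)
    have hkey : 8 * R ^ 3 * C4 ^ 2 * (P₀ ^ 2 * P₁) < (2 * (C₀ : ℝ)) ^ 3 * (P₀ ^ 2 * P₁) := by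
      calc 8 * R ^ 3 * C4 ^ 2 * (P₀ ^ 2 * P₁) = (2 * R * C4 * P₀) ^ 2 * (2 * R * P₁) := by ring
        _ < P ^ 2 * P := hprod
        _ = P ^ 3 := by ring
        _ ≤ A * (P₀ ^ 2 * P₁) := hstruct
        _ ≤ (2 * (C₀ : ℝ)) ^ 3 * (P₀ ^ 2 * P₁) := mul_le_mul_of_nonneg_right hAle (by positivity)
    have hkey' : 8 * R ^ 3 * C4 ^ 2 < (2 * (C₀ : ℝ)) ^ 3 :=
      lt_of_mul_lt_mul_right hkey (by positivity)
    -- exponent bookkeeping: `R³ C4² = C₀^{3(l-1+3ε)+1/2} ≥ C₀³`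
    have hexp : R ^ 3 * C4 ^ 2 = (C₀ : ℝ) ^ (3 * (l - 1 + 3 * ε) + 1 / 2) := by
      rw [hRdef, hC4, ← Real.rpow_natCast ((C₀ : ℝ) ^ (l - 1 + 3 * ε)) 3,
        ← Real.rpow_natCast ((C₀ : ℝ) ^ (1 / 4 : ℝ)) 2, ← Real.rpow_mul hC₀pos.le,
        ← Real.rpow_mul hC₀pos.le, ← Real.rpow_add hC₀pos]
      norm_num
      ring_nf
    have hge : (C₀ : ℝ) ^ (3 : ℝ) ≤ (C₀ : ℝ) ^ (3 * (l - 1 + 3 * ε) + 1 / 2) :=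
      Real.rpow_le_rpow_of_exponent_le hC₀ (by nlinarith)
    have h3 : (C₀ : ℝ) ^ (3 : ℝ) = (C₀ : ℝ) ^ 3 := by exact_mod_cast Real.rpow_natCast (C₀ : ℝ) 3
    have hge' : (C₀ : ℝ) ^ 3 ≤ R ^ 3 * C4 ^ 2 := by
      rw [hexp, ← h3]
      exact hge
    have h8 : (2 * (C₀ : ℝ)) ^ 3 = 8 * ((C₀ : ℝ) ^ 3) := by ring
    have h9 : 8 * ((C₀ : ℝ) ^ 3) ≤ 8 * (R ^ 3 * C4 ^ 2) :=
      mul_le_mul_of_nonneg_left hge' (by norm_num)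
    have h10 : 8 * R ^ 3 * C4 ^ 2 = 8 * (R ^ 3 * C4 ^ 2) := by ring
    rw [h8, h10] at hkey'
    exact absurd (lt_of_lt_of_le hkey' h9) (lt_irrefl _)
  · /- (B): `64 R³ P² ≤ 64 R³ A P₀ < P³ P₀`, so `64 R³ < P P₀ < P²/(2 R C4)`, so `128 R⁴ C4 < P²`;
       but `P² ≤ (2C₀)^{2(l+3ε)} = 2^{2(l+3ε)} C₀^{2(l+3ε)} < 128 C₀^{2(l+3ε)} ≤ 128 R⁴ C4`. -/
    have hB1 : 64 * R ^ 3 * P ^ 2 < P ^ 3 * P₀ := by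
      calc 64 * R ^ 3 * P ^ 2 ≤ 64 * R ^ 3 * (A * P₀) := mul_le_mul_of_nonneg_left hstruct2 (by positivity)
        _ = 64 * R ^ 3 * A * P₀ := by ring
        _ < P ^ 3 * P₀ := mul_lt_mul_of_pos_right hcaseB hP₀pos
    have hB2 : 64 * R ^ 3 < P * P₀ := by
      have h := lt_of_mul_lt_mul_right (show 64 * R ^ 3 * P ^ 2 < P * P₀ * P ^ 2 by nlinarith [hB1])
        (by positivity)
      exact h
    have hB3 : 64 * R ^ 3 * (2 * R * C4) < P * P := by
      calc 64 * R ^ 3 * (2 * R * C4) < P * P₀ * (2 * R * C4) := mul_lt_mul_of_pos_right hB2 (by positivity)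
        _ = P * (2 * R * C4 * P₀) := by ring
        _ ≤ P * P := mul_le_mul_of_nonneg_left hnw.le hPpos.le
    -- `P² ≤ (2C₀)^{2(l+3ε)} = 2^{2(l+3ε)} · C₀^{2(l+3ε)}`
    have hΛ : (0 : ℝ) ≤ 2 * (C₀ : ℝ) := by positivity
    have hPle : P ≤ (2 * (C₀ : ℝ)) ^ (l + 3 * ε) := hA.prod_le
    have hP2 : P * P ≤ (2 : ℝ) ^ (2 * (l + 3 * ε)) * (C₀ : ℝ) ^ (2 * (l + 3 * ε)) := by
      have h1 : P * P ≤ (2 * (C₀ : ℝ)) ^ (l + 3 * ε) * (2 * (C₀ : ℝ)) ^ (l + 3 * ε) :=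
        mul_le_mul hPle hPle hPpos.le (Real.rpow_nonneg hΛ _)
      have h2 : (2 * (C₀ : ℝ)) ^ (l + 3 * ε) * (2 * (C₀ : ℝ)) ^ (l + 3 * ε) =
          (2 : ℝ) ^ (2 * (l + 3 * ε)) * (C₀ : ℝ) ^ (2 * (l + 3 * ε)) := by
        rw [← Real.rpow_add (by positivity : (0 : ℝ) < 2 * (C₀ : ℝ)), Real.mul_rpow (by norm_num) hC₀pos.le]
        ring_nf
      rw [h2] at h1
      exact h1
    have h2lt : (2 : ℝ) ^ (2 * (l + 3 * ε)) < 128 := by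
      have h7 : (2 : ℝ) ^ (2 * (l + 3 * ε)) < (2 : ℝ) ^ (7 : ℝ) :=
        Real.rpow_lt_rpow_of_exponent_lt (by norm_num) (by linarith)
      have h7' : (2 : ℝ) ^ (7 : ℝ) = 128 := by
        rw [show (7 : ℝ) = ((7 : ℕ) : ℝ) by norm_num, Real.rpow_natCast]
        norm_num
      linarith
    have hCexp : (C₀ : ℝ) ^ (2 * (l + 3 * ε)) ≤ (C₀ : ℝ) ^ (4 * (l - 1 + 3 * ε) + 1 / 4) :=
      Real.rpow_le_rpow_of_exponent_le hC₀ (by linarith)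
    have hexp4 : R ^ 3 * (R * C4) = (C₀ : ℝ) ^ (4 * (l - 1 + 3 * ε) + 1 / 4) := by
      rw [hRdef, hC4, ← Real.rpow_natCast ((C₀ : ℝ) ^ (l - 1 + 3 * ε)) 3, ← Real.rpow_mul hC₀pos.le,
        ← Real.rpow_add hC₀pos, ← Real.rpow_add hC₀pos]
      norm_num
      ring_nf
    have hCpos2 : (0 : ℝ) < (C₀ : ℝ) ^ (2 * (l + 3 * ε)) := Real.rpow_pos_of_pos hC₀pos _
    -- chain: `128 · C₀^{4(l-1+3ε)+1/4} = 64 R³ (2 R C4) < P² ≤ 2^{…} C₀^{2(l+3ε)} < 128 C₀^{2(l+3ε)} ≤ 128 C₀^{4(…)+1/4}`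
    have hchain : 128 * (C₀ : ℝ) ^ (4 * (l - 1 + 3 * ε) + 1 / 4) < 128 * (C₀ : ℝ) ^ (4 * (l - 1 + 3 * ε) + 1 / 4) := by
      calc 128 * (C₀ : ℝ) ^ (4 * (l - 1 + 3 * ε) + 1 / 4) = 64 * R ^ 3 * (2 * R * C4) := by
            rw [← hexp4]; ring
        _ < P * P := hB3
        _ ≤ (2 : ℝ) ^ (2 * (l + 3 * ε)) * (C₀ : ℝ) ^ (2 * (l + 3 * ε)) := hP2
        _ ≤ 128 * (C₀ : ℝ) ^ (2 * (l + 3 * ε)) := mul_le_mul_of_nonneg_right h2lt.le hCpos2.le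
        _ ≤ 128 * (C₀ : ℝ) ^ (4 * (l - 1 + 3 * ε) + 1 / 4) := mul_le_mul_of_nonneg_left hCexp (by norm_num)
    exact lt_irrefl _ hchain

/-- THE REACH OF THE LINE (kernel-checked): transfer + off-wall + lever ALONE give the Mazur–Kane law at every
`s ∈ [15/8, 2)` — the deep residual is not needed there because its region is empty (`not_deep`). With the
lever proved at depth `τ₁` instead of `1/4`, the same proof gives `[2 - τ₁/2, 2)`. -/
theorem lawAt_of_offWall_nearWall (hT : TransferAt) (hO : OffWallLaw) (hN : NearWallLaw) {s : ℝ}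
    (hs : 15 / 8 ≤ s) (hs2 : s < 2) : LawAt s := by
  refine hT s (by linarith) hs2 fun l hl1 hl2 => ?_
  intro ε hε hε2 η hη
  obtain ⟨K₁, hK₁⟩ := hO l (by linarith) hl2 ε hε hε2 η hη
  obtain ⟨K₂, hK₂⟩ := hN l (by linarith) hl2 ε hε hε2 η hη
  have h2 := two_le_numShapes hε hε2
  refine ⟨max K₁ K₂, fun C₀ c₁ c₂ c₃ X Y Z hA => ?_⟩
  have hC : (0 : ℝ) ≤ (C₀ : ℝ) ^ (l - 1 + 3 * ε + η) := Real.rpow_nonneg (Nat.cast_nonneg _) _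
  have hO' := hK₁ C₀ c₁ c₂ c₃ X Y Z ⟨0, by omega⟩ ⟨1, by omega⟩ rfl rfl hA
  have hN' := hK₂ C₀ c₁ c₂ c₃ X Y Z ⟨0, by omega⟩ ⟨1, by omega⟩ rfl rfl hA
  refine (Classical.em _).elim (fun h1 => (hO' h1).trans ?_) (fun h1 => ?_)
  · exact mul_le_mul_of_nonneg_right (le_max_left _ _) hC
  · have h2' := not_deep hε.le hε2 (by linarith) hl2 hA ⟨0, by omega⟩ ⟨1, by omega⟩ rfl rfl h1
    exact (hN' h1 h2').trans (mul_le_mul_of_nonneg_right (le_max_right _ _) hC)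

/-- The reach, from the registered stubs: `MazurKaneLaw` restricted to `s ∈ [15/8, 2)` needs only STUBS 1, 2, 3a–3c
(no deep residual); once 1, 2, 3a, 3b land, the single open stub `stub_nearWallR2` gives the first range below Kane's `s ≥ 2`. -/
theorem mazurKaneLaw_high_of (hT : Registered.stub_transfer) (hO : Registered.stub_offWall)
    (hX : Registered.stub_twoRootTameX) (hZ : Registered.stub_twoRootTameZ) (hR : Registered.stub_nearWallR2) :
    ∀ s : ℝ, 15 / 8 ≤ s → s < 2 → LawAt s :=
  fun _ hs hs2 => lawAt_of_offWall_nearWall hT hO (nearWallLaw_of hX hZ hR) hs hs2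

end Summit.ABC.ABC.Cruxes.MazurKaneLaw.CriticalKloostermanPowerfulModuli

end
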